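import Literature.Probability.Percolation.TrapPairCut
import Literature.Probability.Percolation.TrapTermFenceT
import Literature.Combinatorics.SimpleGraph.WalkPrefix
import HarnessLib

/-!
# The asymmetric same-colour pair step (one arm on the tip arc, the other arbitrary): no cut on the free arm

Topic `Literature/Probability/Percolation`; family `crit-perc` / near-critical percolation on `𝕋`.
A brick of the near-critical arm-separation theorem for four arms in the ADJACENT colour
arrangement (P. Nolin, EJP 13 (2008), Thm. 11, `j = 4`, `σ = BBWW` [arXiv 0711.4948: Thm. 10];
the last missing input `hsepAdj` of `Werner2009_lemma63_of_altSeparation_of_adjSeparation`).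

Two arms of the same colour landing on DIFFERENT sides of `∂Λ_{2M}` (Nolin 2008, §4.4, proof of
Lemma 15, last paragraph, does not treat this case; the natural statement with the exploration
from below only is false): the no-cut argument behind Menger's theorem is run, for a cut site on
one arm, in the trapezoid of the OTHER arm, where the first arm does not end on the tip arc. This
file is the asymmetric version of `TrapPairSetting.lean` + `TrapPairRoutes.lean` +
`TrapPairCutCore.lean` + `TrapPairCut.lean` (same proofs, the arm `0` ending on `trapO M`, the arm
`1` ending on `trapO M` or far from all fence zones), concluding with
`PairDataA.not_isCut_of_mem_arm1`: a site of the arm `1` is never a cut. `PairData` embeds into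
`PairDataA` (`y_mem 1 ↦ Or.inl`), and the `PairData`-independent lemmas (`PairData.term_*`,
`tip_mem`, `fin2_eq_of_ne`) are reused, not restated. Contents:

* `PairDataA M n k₀ K T ω` — two disjoint clean open self-avoiding arms `A i : a i ⇝ y i`
  (`i : Fin 2`) of `{n ≤ |v| ≤ 2M}`, the arm `0` ending on `trapO M`, the arm `1` ending on
  `trapO M` as well OR at a site `y 1` with `(y 1)₀ + 3k < 2M` for all the scales `k` (so, in the
  cross-frame application, on the middle of another side), on the raw good event of the
  exploration (`lowestSeq ω T = none`, no `TrapSeqFailRaw M u k₀ K` for `u < T`), with the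
  numerical side conditions — the asymmetric version of `PairData` (`TrapPairSetting.lean`) used
  for two arms of the same colour landing on different sides;
* per term `lowestSeq ω u = (c, z)`: the scale `kOf` (raw-good, `TrapRawOK`), the fence
  `fence : TermFence M c z kOf ω (S c)` stopped at `S c = c ∪ (arms)`;
* the admissible set `Aset = (arms) ∪ ⋃_u (c_u ∪ F_u)` and the targets `Tset = {m_u}`;
* bookkeeping: arms (`norm_le`, `a0_le`, `armSet_subset`), terms (`term_isCrossing`,
  `term_above_of_lt`, `term_below_of_lt`, `term_offLower_of_lt`, `row_gap_of_lt`), fences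
  (`fence_disjoint_arm`, `fence_disjoint_term`, `fence_disjoint_fence`, `term_eq_of_mem_struct`).

Everything here is proved; no named facts are introduced.

## References

* P. Nolin, Near-critical percolation in two dimensions, *Electron. J. Probab.* 13 (2008), §4.4,
  proof of Lemma 15 (arXiv 0711.4948: Lemma 14), last paragraph [Nolin2008].
* H. Kesten, Scaling relations for 2D-percolation, *Comm. Math. Phys.* 109 (1987), Lemma 2
  [Kesten1987].

Tree: `TrapRawOK`, `TrapSeqFailRaw`, `exists_trapRawOK_of_not_failRaw`
(`ArmSeparationRawGood.lean`), `TermFence` and its planar position (`TrapTermFence.lean`),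
`JDomain.lowestSeq*` (`TriLowestCrossing*.lean`), `trapScale`, `triAnnSet`.
-/

noncomputable section

open Set

namespace Literature.Probability.Percolation

open LatticeModels

/-! ### The data -/

/-- **The setting of the pair step** (frame `0`, open colour): two disjoint clean open
self-avoiding arms of `{n ≤ |v| ≤ 2M}` from sites of norm `n` to `trapO M`, on the raw good event
of the exploration of `trapDomain M` in `ω` (all terms `u < T` raw-good on some scale
`k₀ · 32^j`, `j < K`), with `1 ≤ n ≤ M`, `2 ≤ k₀`, `32 k_j + 1 ≤ M`. [cite: Nolin2008, §4.4 Lemma 15 (proof) (arXiv 0711.4948: Lemma 14)] -/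
structure PairDataA (M n k₀ K T : ℕ) (ω : SiteConfig (Site 2)) where
  /-- the starts -/
  a : Fin 2 → Site 2
  /-- the ends, on `trapO M` -/
  y : Fin 2 → Site 2
  /-- the arms -/
  A : (i : Fin 2) → triGraph.Walk (a i) (y i)
  isPath : ∀ i, (A i).IsPath
  supp : ∀ i, ∀ v ∈ (A i).support, v ∈ triAnnSet n (2 * M) ∩ ω
  norm_a : ∀ i, triNorm (a i) = n
  /-- the arm `0` ends on the outer side of the trapezoid -/
  y_mem : y 0 ∈ trapO M
  /-- the arm `1` ends on the outer side too (same frame) or far from every fence zone (cross frame) -/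
  yfar : y 1 ∈ trapO M ∨ ∀ j < K, (y 1) 0 + 3 * (trapScale k₀ j : ℤ) < 2 * M
  clean : ∀ i, ∀ v ∈ (A i).support, triNorm v = 2 * M → v = y i
  disj : ∀ v ∈ (A 0).support, v ∉ (A 1).support
  stop : (trapDomain M).lowestSeq ω T = none
  good : ∀ u < T, ¬ TrapSeqFailRaw M u k₀ K ω
  hn : 1 ≤ n
  hnM : n ≤ M
  hk₀ : 2 ≤ k₀
  hKM : ∀ j < K, 32 * trapScale k₀ j + 1 ≤ M

namespace PairDataA

variable {M n k₀ K T : ℕ} {ω : SiteConfig (Site 2)}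

/-! ### The arms -/

/-- The sites of the two arms. [folklore] -/
def armSet (D : PairDataA M n k₀ K T ω) : Set (Site 2) := {v | ∃ i, v ∈ (D.A i).support}

/-- The stopping set of the fence of a term: the term and the arms. [folklore] -/
def S (D : PairDataA M n k₀ K T ω) (c : Finset (Site 2)) : Set (Site 2) := (↑c : Set (Site 2)) ∪ D.armSet

/-- Bookkeeping (`mem_armSet`). [folklore] -/
theorem mem_armSet (D : PairDataA M n k₀ K T ω) {v : Site 2} {i : Fin 2} (hv : v ∈ (D.A i).support) : v ∈ D.armSet := ⟨i, hv⟩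

/-- Bookkeeping (`norm_le`). [folklore] -/
theorem norm_le (D : PairDataA M n k₀ K T ω) {i : Fin 2} {v : Site 2} (hv : v ∈ (D.A i).support) : triNorm v ≤ 2 * M := by
  have := (mem_triAnnSet.1 (D.supp i v hv).1).2; push_cast at this; exact this

/-- Bookkeeping (`norm_ge`). [folklore] -/
theorem norm_ge (D : PairDataA M n k₀ K T ω) {i : Fin 2} {v : Site 2} (hv : v ∈ (D.A i).support) : (n : ℤ) ≤ triNorm v :=
  (mem_triAnnSet.1 (D.supp i v hv).1).1

/-- Bookkeeping (`mem_omega`). [folklore] -/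
theorem mem_omega (D : PairDataA M n k₀ K T ω) {i : Fin 2} {v : Site 2} (hv : v ∈ (D.A i).support) : v ∈ ω := (D.supp i v hv).2

/-- Bookkeeping (`armSet_norm_le`). [folklore] -/
theorem armSet_norm_le (D : PairDataA M n k₀ K T ω) {v : Site 2} (hv : v ∈ D.armSet) : triNorm v ≤ 2 * M := by
  obtain ⟨i, hv⟩ := hv; exact D.norm_le hv

/-- Bookkeeping (`armSet_subset`). [folklore] -/
theorem armSet_subset (D : PairDataA M n k₀ K T ω) : D.armSet ⊆ ω := fun _ ⟨_, hv⟩ => D.mem_omega hv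

/-- Bookkeeping (`hM`). [folklore] -/
theorem hM (D : PairDataA M n k₀ K T ω) : 1 ≤ M := le_trans D.hn D.hnM

/-- The start of an arm has `v₀ ≤ M` (indeed `|a₀| ≤ |a| = n ≤ M`). [folklore] -/
theorem a0_le (D : PairDataA M n k₀ K T ω) (i : Fin 2) : (D.a i) 0 ≤ M := by
  have h1 : (D.a i) 0 ≤ triNorm (D.a i) := by rw [triNorm_eq_max]; exact (le_max_left _ _).trans (le_max_left _ _)
  have h2 := D.norm_a i
  have h3 : (n : ℤ) ≤ M := by exact_mod_cast D.hnM
  omega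

/-- The two arms are disjoint, symmetric form. [folklore] -/
theorem disj' (D : PairDataA M n k₀ K T ω) {i j : Fin 2} (hij : i ≠ j) {v : Site 2} (hv : v ∈ (D.A i).support) : v ∉ (D.A j).support := by
  fin_cases i <;> fin_cases j
  · exact absurd rfl hij
  · exact D.disj v hv
  · exact fun h => D.disj v h hv
  · exact absurd rfl hij

/-! ### The terms -/

/-- Bookkeeping (`hdual`). [folklore] -/
theorem hdual (D : PairDataA M n k₀ K T ω) : (trapDomain M).DualProp := trapDomain_dualProp D.hM

/-- A term exists only below the stopping index. [folklore] -/
theorem lt_of_some (D : PairDataA M n k₀ K T ω) {u : ℕ} {c : Finset (Site 2)} {z : Site 2} (hu : (trapDomain M).lowestSeq ω u = some (c, z)) : u < T := by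
  by_contra h
  rw [JDomain.lowestSeq_eq_none_of_le D.stop (not_lt.1 h)] at hu
  exact absurd hu (by simp)

open PairData (term_isCrossing term_open term_norm_le tip_mem term_above_of_lt term_offLower_of_lt
  term_disjoint_of_lt term_below_of_lt tip_lt_of_lt term_eq fin2_eq_of_ne)

/-! ### The scale and the fence of a term -/

/-- The index of a raw-good scale of the term. [folklore] -/
def jOf (D : PairDataA M n k₀ K T ω) {u : ℕ} {c : Finset (Site 2)} {z : Site 2} (hu : (trapDomain M).lowestSeq ω u = some (c, z)) : ℕ :=
  Classical.choose (exists_trapRawOK_of_not_failRaw (D.good u (D.lt_of_some hu)) hu)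

/-- Bookkeeping (`jOf_spec`). [folklore] -/
theorem jOf_spec (D : PairDataA M n k₀ K T ω) {u : ℕ} {c : Finset (Site 2)} {z : Site 2} (hu : (trapDomain M).lowestSeq ω u = some (c, z)) :
    D.jOf hu < K ∧ TrapRawOK M c z (trapScale k₀ (D.jOf hu)) ω :=
  Classical.choose_spec (exists_trapRawOK_of_not_failRaw (D.good u (D.lt_of_some hu)) hu)

/-- The raw-good scale of the term. [folklore] -/
def kOf (D : PairDataA M n k₀ K T ω) {u : ℕ} {c : Finset (Site 2)} {z : Site 2} (hu : (trapDomain M).lowestSeq ω u = some (c, z)) : ℕ :=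
  trapScale k₀ (D.jOf hu)

/-- Bookkeeping (`raw`). [folklore] -/
theorem raw (D : PairDataA M n k₀ K T ω) {u : ℕ} {c : Finset (Site 2)} {z : Site 2} (hu : (trapDomain M).lowestSeq ω u = some (c, z)) :
    TrapRawOK M c z (D.kOf hu) ω := (D.jOf_spec hu).2

/-- Bookkeeping (`one_le_kOf`). [folklore] -/
theorem one_le_kOf (D : PairDataA M n k₀ K T ω) {u : ℕ} {c : Finset (Site 2)} {z : Site 2} (hu : (trapDomain M).lowestSeq ω u = some (c, z)) :
    1 ≤ D.kOf hu := one_le_trapScale (by have := D.hk₀; omega) _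

/-- Bookkeeping (`two_le_kOf`). [folklore] -/
theorem two_le_kOf (D : PairDataA M n k₀ K T ω) {u : ℕ} {c : Finset (Site 2)} {z : Site 2} (hu : (trapDomain M).lowestSeq ω u = some (c, z)) :
    2 ≤ D.kOf hu := Nat.mul_le_mul D.hk₀ (Nat.one_le_pow _ _ (by norm_num))

/-- Bookkeeping (`kOf_le`). [folklore] -/
theorem kOf_le (D : PairDataA M n k₀ K T ω) {u : ℕ} {c : Finset (Site 2)} {z : Site 2} (hu : (trapDomain M).lowestSeq ω u = some (c, z)) :
    32 * D.kOf hu + 1 ≤ M := D.hKM _ (D.jOf_spec hu).1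

/-- Bookkeeping (`c_subset_S`). [folklore] -/
theorem c_subset_S (D : PairDataA M n k₀ K T ω) (c : Finset (Site 2)) : (↑c : Set (Site 2)) ⊆ D.S c := Set.subset_union_left

/-- Bookkeeping (`S_norm_le`). [folklore] -/
theorem S_norm_le (D : PairDataA M n k₀ K T ω) {u : ℕ} {c : Finset (Site 2)} {z : Site 2} (hu : (trapDomain M).lowestSeq ω u = some (c, z)) :
    ∀ v ∈ D.S c, triNorm v ≤ 2 * M := by
  rintro v (hv | hv)
  · exact term_norm_le hu (Finset.mem_coe.1 hv)
  · exact D.armSet_norm_le hv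

/-- **The fence of the term, stopped at `c ∪ (arms)`, with a tall vertical crossing through its end point.** [cite: Nolin2008, §4.4 Lemma 15 (proof) (arXiv 0711.4948: Lemma 14)] -/
def fenceT (D : PairDataA M n k₀ K T ω) {u : ℕ} {c : Finset (Site 2)} {z : Site 2} (hu : (trapDomain M).lowestSeq ω u = some (c, z)) :
    TermFenceT M c z (D.kOf hu) ω (D.S c) :=
  Classical.choice ((D.raw hu).nonempty_termFenceT (D.one_le_kOf hu)
    (by have := D.kOf_le hu; omega) (term_isCrossing hu) (D.c_subset_S c) (D.S_norm_le hu))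

/-- **The fence of the term, stopped at `c ∪ (arms)`.** [cite: Nolin2008, §4.4 Lemma 15 (proof) (arXiv 0711.4948: Lemma 14)] -/
def fence (D : PairDataA M n k₀ K T ω) {u : ℕ} {c : Finset (Site 2)} {z : Site 2} (hu : (trapDomain M).lowestSeq ω u = some (c, z)) :
    TermFence M c z (D.kOf hu) ω (D.S c) :=
  (D.fenceT hu).toTermFence

/-- `fence` is the underlying `TermFence` of `fenceT`. [folklore] -/
theorem fence_eq_fenceT (D : PairDataA M n k₀ K T ω) {u : ℕ} {c : Finset (Site 2)} {z : Site 2}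
    (hu : (trapDomain M).lowestSeq ω u = some (c, z)) : D.fence hu = (D.fenceT hu).toTermFence := rfl

/-! ### The admissible set and the targets -/

/-- **The admissible sites**: the arms, the terms, the connections of their fences. [cite: Nolin2008, §4.4 Lemma 15 (proof) (arXiv 0711.4948: Lemma 14)] -/
def Aset (D : PairDataA M n k₀ K T ω) : Set (Site 2) :=
  D.armSet ∪ {v | ∃ (u : ℕ) (c : Finset (Site 2)) (z : Site 2) (hu : (trapDomain M).lowestSeq ω u = some (c, z)),
    v ∈ (↑c : Set (Site 2)) ∨ v ∈ (D.fence hu).F}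

/-- **The targets**: the exterior fence sites of the terms. [cite: Nolin2008, §4.4 Lemma 15 (proof) (arXiv 0711.4948: Lemma 14)] -/
def Tset (D : PairDataA M n k₀ K T ω) : Set (Site 2) :=
  {v | ∃ (u : ℕ) (c : Finset (Site 2)) (z : Site 2) (hu : (trapDomain M).lowestSeq ω u = some (c, z)), v = (D.fence hu).m}

/-- Bookkeeping (`armSet_subset_Aset`). [folklore] -/
theorem armSet_subset_Aset (D : PairDataA M n k₀ K T ω) : D.armSet ⊆ D.Aset := Set.subset_union_left

/-- Bookkeeping (`term_subset_Aset`). [folklore] -/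
theorem term_subset_Aset (D : PairDataA M n k₀ K T ω) {u : ℕ} {c : Finset (Site 2)} {z : Site 2} (hu : (trapDomain M).lowestSeq ω u = some (c, z)) :
    (↑c : Set (Site 2)) ⊆ D.Aset := fun _ hv => Or.inr ⟨u, c, z, hu, Or.inl hv⟩

/-- Bookkeeping (`fence_subset_Aset`). [folklore] -/
theorem fence_subset_Aset (D : PairDataA M n k₀ K T ω) {u : ℕ} {c : Finset (Site 2)} {z : Site 2} (hu : (trapDomain M).lowestSeq ω u = some (c, z)) :
    (D.fence hu).F ⊆ D.Aset := fun _ hv => Or.inr ⟨u, c, z, hu, Or.inr hv⟩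

/-- Bookkeeping (`m_mem_Tset`). [folklore] -/
theorem m_mem_Tset (D : PairDataA M n k₀ K T ω) {u : ℕ} {c : Finset (Site 2)} {z : Site 2} (hu : (trapDomain M).lowestSeq ω u = some (c, z)) :
    (D.fence hu).m ∈ D.Tset := ⟨u, c, z, hu, rfl⟩

/-- The admissible sites are open. [folklore] -/
theorem Aset_subset (D : PairDataA M n k₀ K T ω) : D.Aset ⊆ ω := by
  rintro v (hv | ⟨u, c, z, hu, hv | hv⟩)
  · exact D.armSet_subset hv
  · exact term_open hu hv
  · exact fenceSet_subset ((D.fence hu).F_subset hv)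

/-! ### The planar position of the fences -/

/-- The connection of a fence avoids the arms. [folklore] -/
theorem fence_disjoint_arm (D : PairDataA M n k₀ K T ω) {u : ℕ} {c : Finset (Site 2)} {z : Site 2} (hu : (trapDomain M).lowestSeq ω u = some (c, z))
    {v : Site 2} (hv : v ∈ (D.fence hu).F) : v ∉ D.armSet := fun h =>
  fenceSet_disjoint ((D.fence hu).F_subset hv) (Or.inr h)

/-- The connection of a fence avoids every term. [cite: Nolin2008, §4.4 Lemma 15 (proof) (arXiv 0711.4948: Lemma 14)] -/
theorem fence_disjoint_term (D : PairDataA M n k₀ K T ω) {u v : ℕ} {c c' : Finset (Site 2)} {z z' : Site 2}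
    (hu : (trapDomain M).lowestSeq ω u = some (c, z)) (hv : (trapDomain M).lowestSeq ω v = some (c', z'))
    {x : Site 2} (hx : x ∈ (D.fence hu).F) : x ∉ c' := by
  rcases lt_trichotomy v u with h | rfl | h
  · exact (D.fence hu).not_mem_of_subset_below (term_below_of_lt h hv hu) hx
  · have := (term_eq hu hv).1; subst this
    exact fun h => fenceSet_disjoint ((D.fence hu).F_subset hx) (Or.inl (Finset.mem_coe.2 h))
  · exact (D.fence hu).not_mem_of_offLower (D.raw hu) (D.one_le_kOf hu) (by have := D.kOf_le hu; omega)
      (term_isCrossing hu) (term_isCrossing hv) (term_open hv) (term_offLower_of_lt h hu hv) hx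

/-- **Tips of distinct terms are far apart** in the scale of the lower one: `z 1 + 17 k_u < z' 1`
for `u < v`. [cite: Nolin2008, §4.4 Lemma 15 (proof) (arXiv 0711.4948: Lemma 14)] -/
theorem row_gap_of_lt (D : PairDataA M n k₀ K T ω) {u v : ℕ} (huv : u < v) {c c' : Finset (Site 2)} {z z' : Site 2}
    (hu : (trapDomain M).lowestSeq ω u = some (c, z)) (hv : (trapDomain M).lowestSeq ω v = some (c', z')) :
    z 1 + 17 * D.kOf hu < z' 1 :=
  (D.raw hu).row_gap (D.one_le_kOf hu) (by have := D.kOf_le hu; omega) (term_isCrossing hu)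
    (term_isCrossing hv) (term_open hv) (term_offLower_of_lt huv hu hv) (tip_lt_of_lt huv hu hv)

/-- **Connections of distinct fences are disjoint.** [cite: Nolin2008, §4.4 Lemma 15 (proof) (arXiv 0711.4948: Lemma 14)] -/
theorem fence_disjoint_fence (D : PairDataA M n k₀ K T ω) {u v : ℕ} (huv : u ≠ v) {c c' : Finset (Site 2)} {z z' : Site 2}
    (hu : (trapDomain M).lowestSeq ω u = some (c, z)) (hv : (trapDomain M).lowestSeq ω v = some (c', z'))
    {x : Site 2} (hx : x ∈ (D.fence hu).F) : x ∉ (D.fence hv).F := by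
  intro hx'
  wlog h : u < v generalizing u v c c' z z'
  · exact this huv.symm hv hu hx' hx (lt_of_le_of_ne (not_lt.1 h) huv.symm)
  have hgap := D.row_gap_of_lt h hu hv
  have hk := D.one_le_kOf hu
  by_cases hn : triNorm x ≤ 2 * M
  · have hxa := (mem_fenceSet_inside ((D.fence hv).F_subset hx') hn).2.1
    exact (D.fence hu).not_mem_above_of_row_lt hk (tip_mem hu) (term_isCrossing hv) (by omega)
      (fun w hw => D.fence_disjoint_term hu hv hw) hx hn hxa
  · rw [not_le] at hn
    have h1 := mem_fenceSet_outside ((D.fence hv).F_subset hx') hn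
    have h2 := (fenceSet_box ((D.fence hu).F_subset hx)).2.2.2
    omega

/-- **A site lies in the structure `c_u ∪ F_u` of at most one term.** [folklore] -/
theorem term_eq_of_mem_struct (D : PairDataA M n k₀ K T ω) {u v : ℕ} {c c' : Finset (Site 2)} {z z' : Site 2}
    (hu : (trapDomain M).lowestSeq ω u = some (c, z)) (hv : (trapDomain M).lowestSeq ω v = some (c', z'))
    {x : Site 2} (hxu : x ∈ (↑c : Set (Site 2)) ∨ x ∈ (D.fence hu).F) (hxv : x ∈ (↑c' : Set (Site 2)) ∨ x ∈ (D.fence hv).F) :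
    u = v := by
  by_contra hne
  rcases hxu with hxu | hxu <;> rcases hxv with hxv | hxv
  · rcases lt_or_gt_of_ne hne with h | h
    · exact Finset.disjoint_left.1 (term_disjoint_of_lt h hu hv) (Finset.mem_coe.1 hxu) (Finset.mem_coe.1 hxv)
    · exact Finset.disjoint_left.1 (term_disjoint_of_lt h hv hu) (Finset.mem_coe.1 hxv) (Finset.mem_coe.1 hxu)
  · exact D.fence_disjoint_term hv hu hxv (Finset.mem_coe.1 hxu)
  · exact D.fence_disjoint_term hu hv hxu (Finset.mem_coe.1 hxv)
  · exact D.fence_disjoint_fence hne hu hv hxu hxv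

/-- The fence site of a term is outside `Λ_{2M}`, in particular not an admissible site of `Λ_{2M}`. [folklore] -/
theorem norm_m (D : PairDataA M n k₀ K T ω) {u : ℕ} {c : Finset (Site 2)} {z : Site 2} (hu : (trapDomain M).lowestSeq ω u = some (c, z)) :
    2 * (M : ℤ) < triNorm (D.fence hu).m := (D.fence hu).norm_m (D.one_le_kOf hu) (tip_mem hu)

/-- Distinct terms have distinct fence sites. [folklore] -/
theorem m_ne_of_ne (D : PairDataA M n k₀ K T ω) {u v : ℕ} (huv : u ≠ v) {c c' : Finset (Site 2)} {z z' : Site 2}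
    (hu : (trapDomain M).lowestSeq ω u = some (c, z)) (hv : (trapDomain M).lowestSeq ω v = some (c', z')) :
    (D.fence hu).m ≠ (D.fence hv).m := fun h =>
  D.fence_disjoint_fence huv hu hv (D.fence hu).m_mem (h ▸ (D.fence hv).m_mem)

end PairDataA



open LatticeModels

namespace PairDataA

open PairData (term_isCrossing term_open term_norm_le tip_mem term_above_of_lt term_offLower_of_lt
  term_disjoint_of_lt term_below_of_lt tip_lt_of_lt term_eq fin2_eq_of_ne)

variable {M n k₀ K T : ℕ} {ω : SiteConfig (Site 2)}

/-! ### Final crossings and minimal terms -/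

/-- Bookkeeping (`exists_αF`). [folklore] -/
theorem exists_αF (D : PairDataA M n k₀ K T ω) :
    ∃ a : Finset (Site 2), (trapDomain M).IsCrossing a (D.y 0) ∧ (∀ v ∈ a, v ∈ (D.A 0).support) :=
  by
  classical
  obtain ⟨q, β, γ, -, -, -, -, hsub, hcr⟩ := exists_final_crossing_walk (D.A 0) (D.isPath 0)
    (fun v hv => (D.supp 0 v hv).1) (D.a0_le 0) D.y_mem (D.clean 0)
  exact ⟨γ.support.toFinset, hcr, fun v hv => hsub v (List.mem_toFinset.1 hv)⟩

/-- **The final crossing of the arm `i`** (as a set of sites). [cite: Nolin2008, §4.4 (arXiv 0711.4948: proof of Lemma 14)] -/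
def αF (D : PairDataA M n k₀ K T ω) : Finset (Site 2) := Classical.choose D.exists_αF

/-- Bookkeeping (`αF_isCrossing`). [folklore] -/
theorem αF_isCrossing (D : PairDataA M n k₀ K T ω) : (trapDomain M).IsCrossing D.αF (D.y 0) :=
  (Classical.choose_spec D.exists_αF).1

/-- Bookkeeping (`αF_subset`). [folklore] -/
theorem αF_subset (D : PairDataA M n k₀ K T ω) : ∀ v ∈ D.αF, v ∈ (D.A 0).support :=
  (Classical.choose_spec D.exists_αF).2

/-- Bookkeeping (`αF_open`). [folklore] -/
theorem αF_open (D : PairDataA M n k₀ K T ω) : (↑D.αF : Set (Site 2)) ⊆ ω :=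
  fun v hv => D.mem_omega (D.αF_subset v (Finset.mem_coe.1 hv))

/-- Bookkeeping (`exists_meet`). [folklore] -/
theorem exists_meet (D : PairDataA M n k₀ K T ω) :
    ∃ u, ∃ c z, (trapDomain M).lowestSeq ω u = some (c, z) ∧ (D.αF ∩ c).Nonempty := by
  obtain ⟨u, c, z, hu, hne⟩ := JDomain.exists_lowestSeq_inter_nonempty (trapDomain_cutProp M) D.αF_isCrossing D.αF_open
  exact ⟨u, c, z, hu, hne⟩

open Classical in
/-- **The minimal term of the arm `i`**: the least index of a term met by its final crossing. [cite: Nolin2008, §4.4 (arXiv 0711.4948: proof of Lemma 14)] -/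
def uMin (D : PairDataA M n k₀ K T ω) : ℕ := Nat.find D.exists_meet

open Classical in
/-- Bookkeeping (`uMin_spec`). [folklore] -/
theorem uMin_spec (D : PairDataA M n k₀ K T ω) :
    ∃ c z, (trapDomain M).lowestSeq ω D.uMin = some (c, z) ∧ (D.αF ∩ c).Nonempty :=
  Nat.find_spec D.exists_meet

open Classical in
/-- Bookkeeping (`uMin_min`). [folklore] -/
theorem uMin_min (D : PairDataA M n k₀ K T ω) :
    ∀ v < D.uMin, ∀ c z, (trapDomain M).lowestSeq ω v = some (c, z) → Disjoint D.αF c := by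
  intro v hv c z h
  have := Nat.find_min D.exists_meet hv
  push Not at this
  exact Finset.disjoint_iff_inter_eq_empty.2 (this c z h)

/-- The final crossing of the arm `i` lies above every term before its minimal one. [cite: KestenPTM1982, §2.3 Prop. 2.3] -/
theorem αF_stage (D : PairDataA M n k₀ K T ω) :
    ∀ v c z, v + 1 = D.uMin → (trapDomain M).lowestSeq ω v = some (c, z) → D.αF ⊆ (trapDomain M).above c z :=
  fun v c z hv h => JDomain.subset_above_of_forall_disjoint D.αF_isCrossing D.αF_open v
    (fun v' hv' c' z' h' => D.uMin_min v' (by omega) c' z' h') c z h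

/-- The minimal term meets the final crossing. [folklore] -/
theorem αF_meet (D : PairDataA M n k₀ K T ω) {c : Finset (Site 2)} {z : Site 2}
    (hu : (trapDomain M).lowestSeq ω D.uMin = some (c, z)) : (D.αF ∩ c).Nonempty := by
  obtain ⟨c', z', hu', hne⟩ := D.uMin_spec
  obtain ⟨rfl, rfl⟩ := term_eq hu' hu
  exact hne

/-- Bookkeeping (`y_ne`). [folklore] -/
theorem y_ne (D : PairDataA M n k₀ K T ω) {i j : Fin 2} (hij : i ≠ j) : D.y i ≠ D.y j := fun h =>
  D.disj' hij (D.A i).end_mem_support (by rw [h]; exact (D.A j).end_mem_support)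

/-! ### Canonical routes -/

/-- A prefix of an arm avoiding `zz` is an admissible path avoiding `zz`. [folklore] -/
theorem pathIn_prefix (D : PairDataA M n k₀ K T ω) (i : Fin 2) {x : Site 2} (hx : x ∈ (D.A i).support) {zz : Site 2}
    (hzz : zz ∉ ((D.A i).takeUntil x hx).support) : PathIn triGraph (D.Aset \ {zz}) (D.a i) x := by
  classical
  have hsub : ∀ v ∈ ((D.A i).takeUntil x hx).support, v ∈ D.Aset \ {zz} := fun v hv =>
    ⟨D.armSet_subset_Aset (D.mem_armSet ((D.A i).support_takeUntil_subset_support hx hv)), fun h => hzz (h ▸ hv)⟩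
  exact (PathIn.of_walk_mem_support ((D.A i).takeUntil x hx) hsub ((D.A i).takeUntil x hx).end_mem_support).1

/-- **The fence is reached from its attachment site**: `q → p → … → m` avoiding any `zz` off the
connection and different from `q`. [folklore] -/
theorem pathIn_q_m (D : PairDataA M n k₀ K T ω) {u : ℕ} {c : Finset (Site 2)} {z : Site 2}
    (hu : (trapDomain M).lowestSeq ω u = some (c, z)) {zz : Site 2} (hzF : zz ∉ (D.fence hu).F)
    (hzq : zz ≠ (D.fence hu).q) (hqA : (D.fence hu).q ∈ D.Aset) :
    PathIn triGraph (D.Aset \ {zz}) (D.fence hu).q (D.fence hu).m := by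
  set Tf := D.fence hu
  have hF : Tf.F ⊆ D.Aset \ {zz} := fun v hv => ⟨D.fence_subset_Aset hu hv, fun h => hzF (h ▸ hv)⟩
  have hq' : Tf.q ∈ D.Aset \ {zz} := ⟨hqA, fun h => hzq (Set.mem_singleton_iff.1 h).symm⟩
  exact (PathIn.of_adj hq' (hF Tf.p_mem) Tf.adj).trans (Tf.path.mono hF)

/-- The attachment site of a fence is admissible. [folklore] -/
theorem q_mem_Aset (D : PairDataA M n k₀ K T ω) {u : ℕ} {c : Finset (Site 2)} {z : Site 2}
    (hu : (trapDomain M).lowestSeq ω u = some (c, z)) : (D.fence hu).q ∈ D.Aset := by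
  rcases (D.fence hu).q_mem with h | h
  · exact D.term_subset_Aset hu h
  · exact D.armSet_subset_Aset h

/-- **The canonical route of the arm `i`, avoiding `zz`.** If `zz` is off the arms, off the minimal
term `c` of the arm `i` and off the connection of its fence, some start is joined to the fence
site `m` of `c` by an admissible path avoiding `zz`: along an arm to the attachment site when the
fence is attached to an arm, else along the arm `i` to its final crossing's site on `c`, inside
`c` to the attachment site, then through the connection. [cite: Nolin2008, §4.4 Lemma 15 (proof) (arXiv 0711.4948: Lemma 14)] -/
theorem exists_route (D : PairDataA M n k₀ K T ω) {c : Finset (Site 2)} {z : Site 2}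
    (hu : (trapDomain M).lowestSeq ω D.uMin = some (c, z)) {zz : Site 2} (hzarm : zz ∉ D.armSet)
    (hzc : zz ∉ c) (hzF : zz ∉ (D.fence hu).F) : ∃ i', PathIn triGraph (D.Aset \ {zz}) (D.a i') (D.fence hu).m := by
  classical
  set Tf := D.fence hu
  have hqA := D.q_mem_Aset hu
  rcases Tf.q_mem with hq | ⟨i', hq⟩
  · -- attached to the term: arm `i` to its site `x` on `c`, then inside `c`
    have hzq : zz ≠ Tf.q := fun h => hzc (h ▸ Finset.mem_coe.1 hq)
    obtain ⟨x, hx⟩ := D.αF_meet hu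
    rw [Finset.mem_inter] at hx
    have hxA : x ∈ (D.A 0).support := D.αF_subset x hx.1
    have h1 : PathIn triGraph (D.Aset \ {zz}) (D.a 0) x :=
      D.pathIn_prefix 0 hxA fun h => hzarm (D.mem_armSet ((D.A 0).support_takeUntil_subset_support hxA h))
    have h2 : PathIn triGraph (D.Aset \ {zz}) x Tf.q :=
      ((term_isCrossing hu).conn x hx.2 Tf.q (Finset.mem_coe.1 hq)).mono fun v hv =>
        ⟨D.term_subset_Aset hu hv, fun h => hzc (h ▸ Finset.mem_coe.1 hv)⟩
    exact ⟨0, (h1.trans h2).trans (D.pathIn_q_m hu hzF hzq hqA)⟩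
  · -- attached to the arm `i'`
    have hzq : zz ≠ Tf.q := fun h => hzarm (h ▸ ⟨i', hq⟩)
    have h1 : PathIn triGraph (D.Aset \ {zz}) (D.a i') Tf.q :=
      D.pathIn_prefix i' hq fun h => hzarm (D.mem_armSet ((D.A i').support_takeUntil_subset_support hq h))
    exact ⟨i', h1.trans (D.pathIn_q_m hu hzF hzq hqA)⟩

/-- The origin is not admissible (arm sites have norm `≥ n ≥ 1`, term and fence sites have
`v₀ > M ≥ 1` or norm `> 2M`). [folklore] -/
theorem zero_not_mem_Aset (D : PairDataA M n k₀ K T ω) : (0 : Site 2) ∉ D.Aset := by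
  have h0 : triNorm (0 : Site 2) = 0 := by simp [triNorm]
  have hn : (1 : ℤ) ≤ n := by exact_mod_cast D.hn
  rintro (⟨i, hv⟩ | ⟨u, c, z, hu, hv | hv⟩)
  · have := D.norm_ge hv; omega
  · have h1 := (mem_trapD.1 ((term_isCrossing hu).subset (Finset.mem_coe.1 hv))).1
    simp at h1
    omega
  · by_cases hnn : triNorm (0 : Site 2) ≤ 2 * M
    · have h1 := (mem_trapD.1 (mem_fenceSet_inside ((D.fence hu).F_subset hv) hnn).1).1
      simp at h1
      omega
    · rw [h0] at hnn; omega

/-- **Some admissible route exists** (Menger's first hypothesis). [folklore] -/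
theorem hone (D : PairDataA M n k₀ K T ω) :
    ∃ (s t : Site 2) (q : triGraph.Walk s t), s ∈ ({D.a 0, D.a 1} : Set (Site 2)) ∧ t ∈ D.Tset ∧ ∀ v ∈ q.support, v ∈ D.Aset := by
  obtain ⟨c, z, hu, -⟩ := D.uMin_spec
  have h0 := D.zero_not_mem_Aset
  obtain ⟨i', hp⟩ := D.exists_route hu (fun h => h0 (D.armSet_subset_Aset h)) (fun h => h0 (D.term_subset_Aset hu h))
    (fun h => h0 (D.fence_subset_Aset hu h))
  obtain ⟨w, hw⟩ := hp.exists_walk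
  refine ⟨D.a i', (D.fence hu).m, w, ?_, D.m_mem_Tset hu, fun v hv => (hw v hv).1⟩
  fin_cases i' <;> simp

/-! ### The reach set of a candidate cut -/

/-- **The reach set avoiding `zz`**: admissible sites joined to a start by an admissible path
avoiding `zz`. [folklore] -/
def Reach (D : PairDataA M n k₀ K T ω) (zz : Site 2) : Set (Site 2) := {x | ∃ i, PathIn triGraph (D.Aset \ {zz}) (D.a i) x}

/-- **`zz` is a cut**: an admissible site such that no fence site is reached avoiding it. [folklore] -/
def IsCut (D : PairDataA M n k₀ K T ω) (zz : Site 2) : Prop :=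
  zz ∈ D.Aset ∧ ∀ (u : ℕ) (c : Finset (Site 2)) (z : Site 2) (hu : (trapDomain M).lowestSeq ω u = some (c, z)),
    (D.fence hu).m ∉ D.Reach zz

/-- Bookkeeping (`reach_subset`). [folklore] -/
theorem reach_subset (D : PairDataA M n k₀ K T ω) {zz x : Site 2} (hx : x ∈ D.Reach zz) : x ∈ D.Aset ∧ x ≠ zz := by
  obtain ⟨i, hp⟩ := hx; exact ⟨hp.right_mem.1, hp.right_mem.2⟩

/-- Bookkeeping (`reach_of_pathIn`). [folklore] -/
theorem reach_of_pathIn (D : PairDataA M n k₀ K T ω) {zz x y : Site 2} (hx : x ∈ D.Reach zz)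
    (hp : PathIn triGraph (D.Aset \ {zz}) x y) : y ∈ D.Reach zz := by
  obtain ⟨i, hpx⟩ := hx; exact ⟨i, hpx.trans hp⟩

/-- Bookkeeping (`reach_of_adj`). [folklore] -/
theorem reach_of_adj (D : PairDataA M n k₀ K T ω) {zz x y : Site 2} (hx : x ∈ D.Reach zz) (hy : y ∈ D.Aset) (hyz : y ≠ zz)
    (hadj : triGraph.Adj x y) : y ∈ D.Reach zz :=
  D.reach_of_pathIn hx (PathIn.of_adj (D.reach_subset hx |> fun h => ⟨h.1, h.2⟩) ⟨hy, hyz⟩ hadj)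

/-- A vertex of an arm whose prefix avoids `zz` is reached. [folklore] -/
theorem mem_reach_of_prefix (D : PairDataA M n k₀ K T ω) (i : Fin 2) {x : Site 2} (hx : x ∈ (D.A i).support) {zz : Site 2}
    (hzz : zz ∉ ((D.A i).takeUntil x hx).support) : x ∈ D.Reach zz := ⟨i, D.pathIn_prefix i hx hzz⟩

/-- An arm avoiding `zz` is reached entirely. [folklore] -/
theorem arm_subset_reach (D : PairDataA M n k₀ K T ω) (j : Fin 2) {zz : Site 2} (hzz : zz ∉ (D.A j).support) :
    ∀ x ∈ (D.A j).support, x ∈ D.Reach zz := fun _ hx =>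
  D.mem_reach_of_prefix j hx fun h => hzz ((D.A j).support_takeUntil_subset_support hx h)

/-- A term off `zz` with a reached site is reached entirely. [folklore] -/
theorem term_subset_reach (D : PairDataA M n k₀ K T ω) {u : ℕ} {c : Finset (Site 2)} {z : Site 2}
    (hu : (trapDomain M).lowestSeq ω u = some (c, z)) {zz : Site 2} (hzc : zz ∉ c) {x : Site 2} (hx : x ∈ c)
    (hxr : x ∈ D.Reach zz) : ∀ x' ∈ c, x' ∈ D.Reach zz := fun x' hx' =>
  D.reach_of_pathIn hxr (((term_isCrossing hu).conn x hx x' hx').mono fun _ hv =>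
    ⟨D.term_subset_Aset hu hv, fun h => hzc (h ▸ Finset.mem_coe.1 hv)⟩)

/-- **Under a cut, no site of a fence connection off `zz` is reached.** [folklore] -/
theorem fence_not_reach (D : PairDataA M n k₀ K T ω) {zz : Site 2} (hcutz : D.IsCut zz) {u : ℕ} {c : Finset (Site 2)} {z : Site 2}
    (hu : (trapDomain M).lowestSeq ω u = some (c, z)) (hzF : zz ∉ (D.fence hu).F) :
    ∀ x ∈ (D.fence hu).F, x ∉ D.Reach zz := fun _ hx hxr =>
  hcutz.2 u c z hu (D.reach_of_pathIn hxr (((D.fence hu).pathIn_to_m hx).mono fun _ hv =>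
    ⟨D.fence_subset_Aset hu hv, fun h => hzF (h ▸ hv)⟩))

/-- **Under a cut, the attachment site of a fence off `zz` is not reached.** [folklore] -/
theorem q_not_reach (D : PairDataA M n k₀ K T ω) {zz : Site 2} (hcutz : D.IsCut zz) {u : ℕ} {c : Finset (Site 2)} {z : Site 2}
    (hu : (trapDomain M).lowestSeq ω u = some (c, z)) (hzF : zz ∉ (D.fence hu).F) : (D.fence hu).q ∉ D.Reach zz :=
  fun hq => D.fence_not_reach hcutz hu hzF _ (D.fence hu).p_mem
    (D.reach_of_adj hq (D.fence_subset_Aset hu (D.fence hu).p_mem) (fun h => hzF (h ▸ (D.fence hu).p_mem)) (D.fence hu).adj)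

end PairDataA



open LatticeModels

/-! ### Good sets and the planar contradictions -/

namespace PairDataA

open PairData (term_isCrossing term_open term_norm_le tip_mem term_above_of_lt term_offLower_of_lt
  term_disjoint_of_lt term_below_of_lt tip_lt_of_lt term_eq fin2_eq_of_ne)

variable {M n k₀ K T : ℕ} {ω : SiteConfig (Site 2)}

/-- **A good set** for the arm `0` (minimal term `c = c_{u_0}`): an open connected set of sites
of the trapezoid avoiding the final crossing `α_j` and every term before `c`. [folklore] -/
structure GoodSet (D : PairDataA M n k₀ K T ω) (S : Set (Site 2)) : Prop where
  sub_D : S ⊆ ↑(trapD M)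
  sub_ω : S ⊆ ω
  conn : SiteConn S
  avoid : ∀ v ∈ S, v ∉ D.αF
  stage : ∀ v' < D.uMin, ∀ c' z', (trapDomain M).lowestSeq ω v' = some (c', z') → ∀ v ∈ S, v ∉ c'

namespace GoodSet

variable {D : PairDataA M n k₀ K T ω} {A B : Set (Site 2)}

/-- Union of good sets with a common site. [folklore] -/
theorem union_of_mem (hA : D.GoodSet A) (hB : D.GoodSet B) {a : Site 2} (ha : a ∈ A) (hb : a ∈ B) :
    D.GoodSet (A ∪ B) where
  sub_D := Set.union_subset hA.sub_D hB.sub_D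
  sub_ω := Set.union_subset hA.sub_ω hB.sub_ω
  conn := hA.conn.union_of_mem hB.conn ha hb
  avoid := fun v hv => hv.elim (hA.avoid v) (hB.avoid v)
  stage := fun v' hv' c' z' h v hv => hv.elim (hA.stage v' hv' c' z' h v) (hB.stage v' hv' c' z' h v)

/-- Union of good sets joined by an edge. [folklore] -/
theorem union_of_adj (hA : D.GoodSet A) (hB : D.GoodSet B) {a b : Site 2} (ha : a ∈ A) (hb : b ∈ B)
    (hadj : triGraph.Adj a b) : D.GoodSet (A ∪ B) where
  sub_D := Set.union_subset hA.sub_D hB.sub_D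
  sub_ω := Set.union_subset hA.sub_ω hB.sub_ω
  conn := hA.conn.union_of_adj hB.conn ha hb hadj
  avoid := fun v hv => hv.elim (hA.avoid v) (hB.avoid v)
  stage := fun v' hv' c' z' h v hv => hv.elim (hA.stage v' hv' c' z' h v) (hB.stage v' hv' c' z' h v)

/-- A good set lies in `D ∖ α_j`. [folklore] -/
theorem sub_sdiff (hA : D.GoodSet A) : A ⊆ (↑((trapDomain M).D \ D.αF) : Set (Site 2)) := fun w hw => by
  rw [Finset.coe_sdiff]; exact ⟨hA.sub_D hw, fun h => hA.avoid w hw h⟩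

end GoodSet

/-- **Lemma B for a good set (no low bypass)**: a good set starting on `trapI M` whose only site
on `trapO M` is `b`, lower than the tip of `α_j`, is impossible — it is an open crossing of the
stage of `c` disjoint from `α_j`, so `α_j` could not meet `c`. [cite: Nolin2008, §4.4 Lemma 15 (proof) (arXiv 0711.4948: Lemma 14, last paragraph)] -/
theorem GoodSet.false_of_tip {D : PairDataA M n k₀ K T ω} {S : Set (Site 2)} (hS : D.GoodSet S)
    {c : Finset (Site 2)} {z : Site 2} (hu : (trapDomain M).lowestSeq ω D.uMin = some (c, z))
    (hf : ∃ f ∈ S, f ∈ trapI M) {b : Site 2} (hbS : b ∈ S) (hbO : b ∈ trapO M)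
    (htip : ∀ v ∈ S, v ∈ trapO M → v = b) (hlt : b 1 < (D.y 0) 1) : False := by
  classical
  have hcut := trapDomain_cutProp M
  have hfin : S.Finite := (Finset.finite_toSet (trapD M)).subset hS.sub_D
  set Kf := hfin.toFinset with hKf'
  have hcoe : (↑Kf : Set (Site 2)) = S := hfin.coe_toFinset
  have hmem : ∀ v, v ∈ Kf ↔ v ∈ S := fun v => hfin.mem_toFinset
  have hcr : (trapDomain M).IsCrossing Kf b :=
    { subset := fun v hv => Finset.mem_coe.1 (hS.sub_D ((hmem v).1 hv))
      tip_mem := (hmem b).2 hbS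
      tip_mem_J := hbO
      eq_tip := fun v hv hvJ => htip v ((hmem v).1 hv) hvJ
      exists_start := by obtain ⟨f, hf, hfI⟩ := hf; exact ⟨f, (hmem f).2 hf, hfI⟩
      conn := fun u hu' v hv => by rw [hcoe]; exact hS.conn u ((hmem u).1 hu') v ((hmem v).1 hv) }
  have hKfω : (↑Kf : Set (Site 2)) ⊆ ω := by rw [hcoe]; exact hS.sub_ω
  have hdisjα : Disjoint Kf D.αF := Finset.disjoint_left.2 fun v hv hv' => hS.avoid v ((hmem v).1 hv) hv'
  have hKabove : ∀ v' c' z', v' + 1 = D.uMin → (trapDomain M).lowestSeq ω v' = some (c', z') →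
      Kf ⊆ (trapDomain M).above c' z' :=
    fun v' c' z' hv' h => JDomain.subset_above_of_forall_disjoint hcr hKfω v'
      (fun v'' hv'' c'' z'' h'' => Finset.disjoint_left.2 fun x hx hx'' =>
        hS.stage v'' (by omega) c'' z'' h'' x ((hmem x).1 hx) hx'') c' z' h
  have := JDomain.disjoint_of_stage_crossing hcut D.hdual hu hcr hKfω hKabove (D.αF_isCrossing) hdisjα
    (by simpa using hlt)
  obtain ⟨x, hx⟩ := D.αF_meet hu
  rw [Finset.mem_inter] at hx
  exact Finset.disjoint_left.1 this hx.1 hx.2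

/-- **Lemma A for a good set (no high bypass)**: a good set containing a site of `Tp` or of the
tip arc above the tip of `α_j` contains no site of `c`. [cite: Nolin2008, §4.4 Lemma 15 (proof) (arXiv 0711.4948: Lemma 14, last paragraph)] -/
theorem GoodSet.not_mem_term {D : PairDataA M n k₀ K T ω} {S : Set (Site 2)} (hS : D.GoodSet S)
    {c : Finset (Site 2)} {z : Site 2} (hu : (trapDomain M).lowestSeq ω D.uMin = some (c, z))
    {r : Site 2} (hrS : r ∈ S) (hr : r ∈ (trapDomain M).Tp ∪ (trapDomain M).Jabove (D.y 0)) :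
    ∀ v ∈ S, v ∉ c := fun _ hvS hvc =>
  Set.disjoint_left.1 (JDomain.disjoint_term_of_conn_ref (trapDomain_cutProp M) D.hdual hu (D.αF_isCrossing)
    (D.αF_open) (D.αF_stage) hS.sub_sdiff hS.conn hrS hr) hvS (Finset.mem_coe.2 hvc)

/-- **The tip of the minimal term is lower than the tip of the arm** when it is off `α_j`. [folklore] -/
theorem tip_row_lt (D : PairDataA M n k₀ K T ω) {c : Finset (Site 2)} {z : Site 2}
    (hu : (trapDomain M).lowestSeq ω D.uMin = some (c, z)) (hzα : z ∉ D.αF) : z 1 < (D.y 0) 1 := by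
  have hcut := trapDomain_cutProp M
  have hc := term_isCrossing hu
  have hα := D.αF_isCrossing
  have hL : c ⊆ (trapDomain M).lower D.αF (D.y 0) :=
    JDomain.term_subset_lower hcut D.hdual hu hα (D.αF_open) (D.αF_stage)
  have hzO := tip_mem hu
  have hzy : z ≠ D.y 0 := fun h => hzα (h ▸ hα.tip_mem)
  have hle : ¬ (D.y 0) 1 < z 1 := fun hlt => by
    have hza : z ∈ (trapDomain M).above D.αF (D.y 0) := hα.mem_above_of_mem_Jabove (mem_trapDomain_Jabove.2 ⟨hzO, hlt⟩)
    exact (JDomain.mem_lower_iff_not_mem_above (hc.subset hc.tip_mem)).1 (hL hc.tip_mem) hza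
  have hne : z 1 ≠ (D.y 0) 1 := fun h => hzy (eq_of_mem_trapO hzO (D.y_mem) h)
  omega

/-- **A good set through the tip of the minimal term** (starting on `trapI M`, meeting `trapO M`
only at `z`) is impossible. [cite: Nolin2008, §4.4 Lemma 15 (proof) (arXiv 0711.4948: Lemma 14, last paragraph)] -/
theorem GoodSet.false_of_tip_mem {D : PairDataA M n k₀ K T ω} {S : Set (Site 2)} (hS : D.GoodSet S)
    {c : Finset (Site 2)} {z : Site 2} (hu : (trapDomain M).lowestSeq ω D.uMin = some (c, z))
    (hf : ∃ f ∈ S, f ∈ trapI M) (hzS : z ∈ S) (htip : ∀ v ∈ S, v ∈ trapO M → v = z) : False :=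
  hS.false_of_tip hu hf hzS (tip_mem hu) htip (D.tip_row_lt hu (hS.avoid z hzS))

/-- **A good set attached to the fence of the minimal term** — containing a site `w₀` of `c` and
the attachment site `q` of the fence of `c`, starting on `trapI M`, and missing `trapO M` — is
impossible: follow the fence connection from `q` out of `Λ_{2M}` (see the module docstring). [cite: Nolin2008, §4.4 Lemma 15 (proof) (arXiv 0711.4948: Lemma 14, last paragraph)] -/
theorem GoodSet.false_of_fence {D : PairDataA M n k₀ K T ω} {S : Set (Site 2)} (hS : D.GoodSet S)
    {c : Finset (Site 2)} {z : Site 2} (hu : (trapDomain M).lowestSeq ω D.uMin = some (c, z))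
    (hf : ∃ f ∈ S, f ∈ trapI M) (hO : ∀ v ∈ S, v ∉ trapO M) {w₀ : Site 2} (hw₀ : w₀ ∈ S) (hw₀c : w₀ ∈ c)
    (hq : (D.fence hu).q ∈ S) : False := by
  classical
  have hcut := trapDomain_cutProp M
  have hc := term_isCrossing hu
  have hzO : z ∈ trapO M := tip_mem hu
  have hk := D.one_le_kOf hu
  set Tf := D.fence hu with hTf
  have hqO : Tf.q ∉ trapO M := hO _ hq
  have hqD : Tf.q ∈ trapD M := hS.sub_D hq
  have hqz : Tf.q ≠ z := fun h => hqO (by rw [h]; exact hzO)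
  by_cases hpn : triNorm Tf.p ≤ 2 * M
  swap
  · -- the attachment site is a boundary site next to the exterior site `p`: top-type, in `Tp`
    rw [not_le] at hpn
    have hrow := mem_fenceSet_outside (Tf.F_subset Tf.p_mem) hpn
    have hN := nType_of_adj_exterior hqD hzO hqz hpn Tf.adj hrow
    have hqTp : Tf.q ∈ (trapDomain M).Tp := by
      rcases Finset.mem_union.1 hN with h | h
      · exact h
      · exact absurd (mem_trapDomain_Jabove.1 h).1 hqO
    exact hS.not_mem_term hu hq (Finset.mem_union_left _ hqTp) w₀ hw₀ hw₀c
  -- follow the connection from `p` to its first exit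
  obtain ⟨x', e, hx'n, hen, -, hadj, hpath⟩ := Tf.exists_exit hk hzO Tf.p_mem hpn
  obtain ⟨S₁, hS₁, hpS₁, htS₁⟩ := hpath.exists_support
  have hS₁F : ∀ v ∈ S₁, v ∈ Tf.F := fun v hv => (hS₁ hv).2
  have hS₁n : ∀ v ∈ S₁, triNorm v ≤ 2 * M := fun v hv => (hS₁ hv).1
  have hS₁in : ∀ v ∈ S₁, v ∈ trapD M ∧ v ∈ (trapDomain M).above c z ∧ v ∉ c := fun v hv =>
    mem_fenceSet_inside (Tf.F_subset (hS₁F v hv)) (hS₁n v hv)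
  have hS₁arm : ∀ v ∈ S₁, v ∉ D.armSet := fun v hv => D.fence_disjoint_arm hu (hS₁F v hv)
  have hS₁good : D.GoodSet S₁ :=
    { sub_D := fun v hv => Finset.mem_coe.2 (hS₁in v hv).1
      sub_ω := fun v hv => fenceSet_subset (Tf.F_subset (hS₁F v hv))
      conn := fun x hx y hy => (htS₁ x hx).symm.trans (htS₁ y hy)
      avoid := fun v hv h => hS₁arm v hv (D.mem_armSet (D.αF_subset v h))
      stage := fun v' _ c' z' h v hv => D.fence_disjoint_term hu h (hS₁F v hv) }
  have hpS : Tf.p ∈ S₁ := hpS₁.left_mem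
  have hbig : D.GoodSet (S ∪ S₁) := hS.union_of_adj hS₁good hq hpS Tf.adj
  by_cases hr : ∃ r ∈ S₁, r ∈ (trapDomain M).Tp ∪ (trapDomain M).Jabove (D.y 0)
  · obtain ⟨r, hrS, hr⟩ := hr
    exact hbig.not_mem_term hu (Or.inr hrS) hr w₀ (Or.inl hw₀) hw₀c
  push Not at hr
  -- rows of the `trapO`-sites of `S₁` are below the tip of `α_j`
  have hrowO : ∀ b ∈ S₁, b ∈ trapO M → b 1 < (D.y 0) 1 := by
    intro b hbS hbO
    have h1 : ¬ (D.y 0) 1 < b 1 := fun h => hr b hbS (Finset.mem_union_right _ (mem_trapDomain_Jabove.2 ⟨hbO, h⟩))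
    have h2 : b ≠ D.y 0 := fun h => hS₁arm b hbS (h ▸ D.mem_armSet (D.A 0).end_mem_support)
    have h3 : b 1 ≠ (D.y 0) 1 := fun h => h2 (eq_of_mem_trapO hbO (D.y_mem) h)
    omega
  -- the last inside site `x'` is top-type for `z`, hence on `trapO`
  have hx'S : x' ∈ S₁ := hpS₁.right_mem
  have hx'D := (hS₁in x' hx'S).1
  have hx'b : triNorm x' = 2 * M := triNorm_eq_of_adj_exterior hx'D hen hadj
  have hx'z : x' ≠ z := fun h => (hS₁in x' hx'S).2.2 (h ▸ hc.tip_mem)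
  have hx'O : x' ∈ trapO M := by
    rcases sType_or_nType hx'D hx'b hzO hx'z with hS' | hN
    · exact absurd (hS₁in x' hx'S).2.1 (hc.not_mem_above_of_mem_Bt_union hcut hS')
    · rcases Finset.mem_union.1 hN with h | h
      · exact absurd (Finset.mem_union_left _ h) (hr x' hx'S)
      · exact (mem_trapDomain_Jabove.1 h).1
  -- the first `trapO`-site `b` along the connection from `p`, and the continuation `S₂` before it
  obtain ⟨S₂, b, hS₂, hS₂O, hbS, hbO, hgood⟩ : ∃ (S₂ : Set (Site 2)) (b : Site 2), S₂ ⊆ S₁ ∧ (∀ v ∈ S₂, v ∉ trapO M) ∧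
      b ∈ S₁ ∧ b ∈ trapO M ∧ D.GoodSet (S ∪ S₂ ∪ {b}) := by
    have hsingle : ∀ b ∈ S₁, D.GoodSet ({b} : Set (Site 2)) := fun b hb =>
      { sub_D := fun v hv => by rw [Set.mem_singleton_iff.1 hv]; exact hS₁good.sub_D hb
        sub_ω := fun v hv => by rw [Set.mem_singleton_iff.1 hv]; exact hS₁good.sub_ω hb
        conn := siteConn_singleton b
        avoid := fun v hv => by rw [Set.mem_singleton_iff.1 hv]; exact hS₁good.avoid b hb
        stage := fun v' hv' c' z' h v hv => by rw [Set.mem_singleton_iff.1 hv]; exact hS₁good.stage v' hv' c' z' h b hb }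
    by_cases hpO : Tf.p ∈ trapO M
    · refine ⟨∅, Tf.p, Set.empty_subset _, fun v hv => absurd hv (Set.notMem_empty v), hpS, hpO, ?_⟩
      rw [Set.union_empty]
      exact hS.union_of_adj (hsingle _ hpS) hq (Set.mem_singleton _) Tf.adj
    · obtain ⟨a, b, haO, hbO, hbS, hab, hpa⟩ := hpS₁.exit (R := (↑(trapO M) : Set (Site 2))ᶜ) hpO (fun h => h hx'O)
      obtain ⟨S₂, hS₂, hpS₂, htS₂⟩ := hpa.exists_support
      have hbO' : b ∈ trapO M := not_not.1 hbO
      have hS₂S₁ : S₂ ⊆ S₁ := fun v hv => (hS₂ hv).2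
      have hS₂good : D.GoodSet S₂ :=
        { sub_D := fun v hv => hS₁good.sub_D (hS₂S₁ hv)
          sub_ω := fun v hv => hS₁good.sub_ω (hS₂S₁ hv)
          conn := fun x hx y hy => (htS₂ x hx).symm.trans (htS₂ y hy)
          avoid := fun v hv => hS₁good.avoid v (hS₂S₁ hv)
          stage := fun v' hv' c' z' h v hv => hS₁good.stage v' hv' c' z' h v (hS₂S₁ hv) }
      refine ⟨S₂, b, hS₂S₁, fun v hv => (hS₂ hv).1, hbS, hbO', ?_⟩
      exact (hS.union_of_adj hS₂good hq hpS₂.left_mem Tf.adj).union_of_adj (hsingle b hbS)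
        (Or.inr hpS₂.right_mem) (Set.mem_singleton b) hab
  -- `S ∪ S₂ ∪ {b}` has the single `trapO`-site `b`, lower than the tip of `α_j`: Lemma B
  refine hgood.false_of_tip hu ?_ (Set.mem_union_right _ (Set.mem_singleton b)) hbO ?_ (hrowO b hbS hbO)
  · obtain ⟨f, hf', hfI⟩ := hf; exact ⟨f, Or.inl (Or.inl hf'), hfI⟩
  · rintro v ((hv | hv) | hv) hvO
    · exact absurd hvO (hO v hv)
    · exact absurd hvO (hS₂O v hv)
    · exact Set.mem_singleton_iff.1 hv

end PairDataA



open LatticeModels Literature.Combinatorics.SimpleGraph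

namespace PairDataA

open PairData (term_isCrossing term_open term_norm_le tip_mem term_above_of_lt term_offLower_of_lt
  term_disjoint_of_lt term_below_of_lt tip_lt_of_lt term_eq fin2_eq_of_ne)

variable {M n k₀ K T : ℕ} {ω : SiteConfig (Site 2)}

/-! ### Geometry of an attachment to an arm -/

/-- The start of an arm is far inside: `a₀ ≤ z₀ - 7k` for every term tip `z` and scale `k ≤ M/32`. [folklore] -/
theorem a0_le_far (D : PairDataA M n k₀ K T ω) (i : Fin 2) {u : ℕ} {c : Finset (Site 2)} {z : Site 2}
    (hu : (trapDomain M).lowestSeq ω u = some (c, z)) : (D.a i) 0 ≤ z 0 - 7 * D.kOf hu := by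
  have h1 := D.a0_le i
  have h2 := (trapO_coord (tip_mem hu)).1
  have h3 := D.kOf_le hu
  omega

/-- **An attachment site on an arm lies in the fence zone above the term**: if the fence of the
term `c` (tip `z`, scale `k`) is attached at a site `q` of the arm `i` off `c`, then `q` is off
`lower c z` and in the `3k`-box about `z` (`q` is a neighbour of the first connection site `p`:
inside, `p ∈ above c`; outside, `q` is the end of the arm, on the tip arc above `z`). [cite: Nolin2008, §4.4 Lemma 15 (proof) (arXiv 0711.4948: Lemma 14)] -/
theorem attach_geom (D : PairDataA M n k₀ K T ω) {u : ℕ} {c : Finset (Site 2)} {z : Site 2}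
    (hu : (trapDomain M).lowestSeq ω u = some (c, z)) (hqA : (D.fence hu).q ∈ (D.A 1).support)
    (hqc : (D.fence hu).q ∉ c) :
    (D.fence hu).q ∉ (trapDomain M).lower c z ∧
      (z 0 - 3 * D.kOf hu ≤ (D.fence hu).q 0 ∧ (D.fence hu).q 0 ≤ z 0 + 3 * D.kOf hu ∧
        z 1 - 3 * D.kOf hu ≤ (D.fence hu).q 1 ∧ (D.fence hu).q 1 ≤ z 1 + 3 * D.kOf hu) := by
  set Tf := D.fence hu
  have hc := term_isCrossing hu
  have hzO := tip_mem hu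
  have hz := trapO_coord hzO
  have hk2 := D.two_le_kOf hu
  have hkM := D.kOf_le hu
  have hpF := Tf.F_subset Tf.p_mem
  have hpbox := fenceSet_box hpF
  have h0 := triGraph_adj_coord Tf.adj 0
  have h1 := triGraph_adj_coord Tf.adj 1
  have hqn : triNorm Tf.q ≤ 2 * M := D.norm_le hqA
  have hqD : Tf.q ∈ trapD M := mem_trapD_of_triNorm_le (by omega) hqn
  have hbox : z 0 - 3 * D.kOf hu ≤ Tf.q 0 ∧ Tf.q 0 ≤ z 0 + 3 * D.kOf hu ∧
      z 1 - 3 * D.kOf hu ≤ Tf.q 1 ∧ Tf.q 1 ≤ z 1 + 3 * D.kOf hu := by omega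
  refine ⟨?_, hbox⟩
  have habove : Tf.q ∈ (trapDomain M).above c z := by
    by_cases hpn : triNorm Tf.p ≤ 2 * M
    · have hpa := (mem_fenceSet_inside hpF hpn).2.1
      exact JDomain.mem_above_of_adj hpa hqD hqc Tf.adj.symm
    · rw [not_le] at hpn
      have hrow := mem_fenceSet_outside hpF hpn
      have hqb : triNorm Tf.q = 2 * M := triNorm_eq_of_adj_exterior hqD hpn Tf.adj
      have hqy : Tf.q = D.y 1 := D.clean 1 _ hqA hqb
      have hqO : Tf.q ∈ trapO M := by
        rcases D.yfar with h | h
        · rw [hqy]; exact h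
        · exfalso
          have := h _ (D.jOf_spec hu).1
          rw [← hqy] at this
          change Tf.q 0 + 3 * (D.kOf hu : ℤ) < 2 * M at this
          omega
      have hne : Tf.q 1 ≠ z 1 := fun h => hqc (by rw [eq_of_mem_trapO hqO hzO h]; exact hc.tip_mem)
      have hq1 : z 1 ≤ Tf.q 1 := by omega
      exact hc.mem_above_of_mem_Jabove (mem_trapDomain_Jabove.2 ⟨hqO, lt_of_le_of_ne hq1 hne.symm⟩)
  exact fun hl => (JDomain.mem_lower_iff_not_mem_above hqD).1 hl habove

/-- **If the fence of a term is attached at the end of the arm `1`, that end is on `trapO M`.** In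
the cross-frame alternative of `yfar` the attachment site, which lies in the `3k`-box of the tip,
cannot be the far end `y 1`. [folklore] -/
theorem y1_mem_trapO_of_q_eq (D : PairDataA M n k₀ K T ω) {u : ℕ} {c : Finset (Site 2)} {z : Site 2}
    (hu : (trapDomain M).lowestSeq ω u = some (c, z))
    (hqbox : z 0 - 3 * D.kOf hu ≤ (D.fence hu).q 0 ∧ (D.fence hu).q 0 ≤ z 0 + 3 * D.kOf hu ∧
        z 1 - 3 * D.kOf hu ≤ (D.fence hu).q 1 ∧ (D.fence hu).q 1 ≤ z 1 + 3 * D.kOf hu)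
    (hqy : (D.fence hu).q = D.y 1) : D.y 1 ∈ trapO M := by
  rcases D.yfar with h | h
  · exact h
  · exfalso
    have h1 := h _ (D.jOf_spec hu).1
    have hz := (trapO_coord (tip_mem hu)).1
    rw [← hqy] at h1
    change (D.fence hu).q 0 + 3 * (D.kOf hu : ℤ) < 2 * M at h1
    omega

/-! ### The stage lemma -/

/-- **The stage lemma.** Under the cut hypothesis for a site `zz` of the arm `i`, let `c` be the
minimal term of the other arm `j` and `w₀ ∈ c` a site of the arm `i` at or before `zz` such that
every site of `lower c` on the arm up to `zz` is at or before `w₀`. Then the arm `i` up to `zz`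
meets no term before `c`. [cite: Nolin2008, §4.4 Lemma 15 (proof) (arXiv 0711.4948: Lemma 14, last paragraph)] -/
theorem prefix_disjoint_earlier (D : PairDataA M n k₀ K T ω) {zz : Site 2} (hcutz : D.IsCut zz)
    (hzz : zz ∈ (D.A 1).support) {c : Finset (Site 2)} {z : Site 2}
    (hu : (trapDomain M).lowestSeq ω D.uMin = some (c, z))
    {w₀ : Site 2} (hw₀c : w₀ ∈ c) (hw₀z : w₀ ∈ ((D.A 1).takeUntil zz hzz).support)
    (hbetween : ∀ v ∈ ((D.A 1).takeUntil zz hzz).support, v ∈ (trapDomain M).lower c z →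
      v ∈ ((D.A 1).takeUntil w₀ ((D.A 1).support_takeUntil_subset_support hzz hw₀z)).support) :
    ∀ v' < D.uMin, ∀ c' z', (trapDomain M).lowestSeq ω v' = some (c', z') →
      ∀ t ∈ ((D.A 1).takeUntil zz hzz).support, t ∉ c' := by
  classical
  have hij : (1 : Fin 2) ≠ 0 := by decide
  intro v' hv' c' z' h t ht htc'
  have hw₀A : w₀ ∈ (D.A 1).support := (D.A 1).support_takeUntil_subset_support hzz hw₀z
  have hc'below := term_below_of_lt hv' h hu
  have hc'low : ∀ x ∈ c', x ∈ (trapDomain M).lower c z := fun x hx => JDomain.mem_lower.2 (Or.inr (hc'below hx))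
  have hdisj : Disjoint c' c := term_disjoint_of_lt hv' h hu
  -- `zz ∉ c'`
  have hzc' : zz ∉ c' := by
    intro hz'
    have h1 := hbetween zz (SimpleGraph.Walk.end_mem_support _) (hc'low zz hz')
    by_cases hw : w₀ = zz
    · exact Finset.disjoint_left.1 hdisj hz' (hw ▸ hw₀c)
    · exact notMem_takeUntil_of_mem_takeUntil (D.A 1) hzz hw₀z hw hw₀A h1
  have htz : t ≠ zz := fun e => hzc' (e ▸ htc')
  have htA : t ∈ (D.A 1).support := (D.A 1).support_takeUntil_subset_support hzz ht
  -- `t`, hence all of `c'`, is reached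
  have htR : t ∈ D.Reach zz := D.mem_reach_of_prefix 1 htA (notMem_takeUntil_of_mem_takeUntil (D.A 1) hzz ht htz htA)
  have hc'R : ∀ x ∈ c', x ∈ D.Reach zz := D.term_subset_reach h hzc' htc' htR
  -- the fence of `c'` is attached to the arm `i` at or after `zz`
  set Tf := D.fence h with hTf
  have hzF : zz ∉ Tf.F := fun hF => D.fence_disjoint_arm h hF ⟨1, hzz⟩
  have hqR : Tf.q ∉ D.Reach zz := D.q_not_reach hcutz h hzF
  have hqc' : Tf.q ∉ c' := fun hq => hqR (hc'R _ hq)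
  have hqA : Tf.q ∈ (D.A 1).support := by
    rcases Tf.q_mem with hq | ⟨i', hq⟩
    · exact absurd (Finset.mem_coe.1 hq) hqc'
    · by_cases hi' : i' = 0
      · rw [hi'] at hq
        exact absurd (D.arm_subset_reach 0 (D.disj' hij hzz) _ hq) hqR
      · rw [fin2_eq_of_ne hij hi'] at hq; exact hq
  have hzq : zz ∈ ((D.A 1).takeUntil Tf.q hqA).support := by
    by_contra hno
    exact hqR (D.mem_reach_of_prefix 1 hqA hno)
  -- the approach of the arm `i` to the fence zone of `c'`
  obtain ⟨hqlow, hqbox⟩ := D.attach_geom h hqA hqc'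
  have hk := D.one_le_kOf h
  have hkM := D.kOf_le h
  obtain ⟨ℓ', s', β', hℓs', γ'', hdec, hℓ'c', -, hγ''p, -, -⟩ := exists_last_contact (D.raw h) hk (by omega)
    (term_isCrossing h) (D.A 1) (D.isPath 1) (fun v hv => D.norm_le hv) (fun v hv => D.mem_omega hv) (D.a0_le_far 1 h)
    hqA hqbox hqlow
  have hpath : ((D.A 1).takeUntil Tf.q hqA).IsPath := (D.isPath 1).takeUntil _
  have hzℓ' : zz ≠ ℓ' := fun e => hzc' (e ▸ hℓ'c')
  -- position of `zz` in the splitting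
  have hzpos := (SimpleGraph.Walk.mem_support_append_iff _ _).1 (hdec ▸ hzq)
  rcases hzpos with hzβ | hzγ
  · -- `zz` before `ℓ'`: then `ℓ'`, reached, is joined to `q` off `zz`
    have hzr : zz ∉ (SimpleGraph.Walk.cons hℓs' γ'').support := fun hz2 => by
      rcases ((mem_support_right_iff hpath hdec).1 hz2).2 with h' | h'
      · exact h' hzβ
      · exact hzℓ' h'
    have hsub : ∀ v ∈ (SimpleGraph.Walk.cons hℓs' γ'').support, v ∈ D.Aset \ {zz} := fun v hv => by
      have hv' : v ∈ ((D.A 1).takeUntil Tf.q hqA).support := by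
        rw [hdec, SimpleGraph.Walk.mem_support_append_iff]; exact Or.inr hv
      exact ⟨D.armSet_subset_Aset (D.mem_armSet ((D.A 1).support_takeUntil_subset_support hqA hv')), fun e => hzr (e ▸ hv)⟩
    have hp : PathIn triGraph (D.Aset \ {zz}) ℓ' Tf.q :=
      (PathIn.of_walk_mem_support (SimpleGraph.Walk.cons hℓs' γ'') hsub (SimpleGraph.Walk.end_mem_support _)).1
    exact hqR (D.reach_of_pathIn (hc'R ℓ' hℓ'c') hp)
  · -- `zz` at or after `ℓ'`
    rw [SimpleGraph.Walk.support_cons, List.mem_cons] at hzγ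
    rcases hzγ with hz1 | hzγ
    · exact hzℓ' hz1
    -- `w₀` is at or before `zz`, hence in the splitting too
    have hw₀q : w₀ ∈ ((D.A 1).takeUntil Tf.q hqA).support := support_takeUntil_subset_of_mem (D.A 1) hqA hzq hw₀z
    have hw₀ℓ' : w₀ ≠ ℓ' := fun e => Finset.disjoint_left.1 hdisj hℓ'c' (e ▸ hw₀c)
    rcases (SimpleGraph.Walk.mem_support_append_iff _ _).1 (hdec ▸ hw₀q) with hwβ | hwγ
    · -- `w₀` before `ℓ'`: but `ℓ' ∈ lower c` lies before `zz`, hence before `w₀` — contradiction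
      have hβeq : β' = ((D.A 1).takeUntil Tf.q hqA).takeUntil ℓ' (hdec ▸ (SimpleGraph.Walk.mem_support_append_iff _ _).2 (Or.inl β'.end_mem_support)) :=
        prefix_eq_takeUntil hpath hdec _
      have hℓ'A : ℓ' ∈ (D.A 1).support := (D.A 1).support_takeUntil_subset_support hqA
        (hdec ▸ (SimpleGraph.Walk.mem_support_append_iff _ _).2 (Or.inl β'.end_mem_support))
      have hw₀ℓ : w₀ ∈ ((D.A 1).takeUntil ℓ' hℓ'A).support := by
        have : ((D.A 1).takeUntil Tf.q hqA).takeUntil ℓ' (hdec ▸ (SimpleGraph.Walk.mem_support_append_iff _ _).2 (Or.inl β'.end_mem_support)) =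
            (D.A 1).takeUntil ℓ' hℓ'A := SimpleGraph.Walk.takeUntil_takeUntil _ _ _
        rw [← this, ← hβeq]; exact hwβ
      -- `ℓ'` is at or before `zz`: otherwise `zz ∈ takeUntil ℓ' = β'`, but `zz ∈ γ''`
      have hℓ'z : ℓ' ∈ ((D.A 1).takeUntil zz hzz).support := by
        rcases mem_takeUntil_or (D.A 1) hzz hℓ'A with h' | h'
        · exact h'
        · exfalso
          have : ((D.A 1).takeUntil Tf.q hqA).takeUntil ℓ' (hdec ▸ (SimpleGraph.Walk.mem_support_append_iff _ _).2 (Or.inl β'.end_mem_support)) =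
              (D.A 1).takeUntil ℓ' hℓ'A := SimpleGraph.Walk.takeUntil_takeUntil _ _ _
          have hzβ' : zz ∈ β'.support := by rw [hβeq, this]; exact h'
          rcases ((mem_support_right_iff hpath hdec).1 (List.mem_cons_of_mem _ hzγ)).2 with h'' | h''
          · exact h'' hzβ'
          · exact hzℓ' h''
      have h2 := hbetween ℓ' hℓ'z (hc'low ℓ' hℓ'c')
      exact notMem_takeUntil_of_mem_takeUntil (D.A 1) hℓ'A hw₀ℓ hw₀ℓ' hw₀A h2
    · rw [SimpleGraph.Walk.support_cons, List.mem_cons] at hwγ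
      rcases hwγ with hw1 | hwγ
      · exact hw₀ℓ' hw1
      -- `w₀` on the piece off `lower c'` inside the `7k'`-box: the outer ring excludes `w₀ ∈ c`
      obtain ⟨-, -, -, hbox⟩ := hγ''p w₀ hwγ
      exact not_mem_of_box7_offLower (D.raw h) hk (by omega) (term_isCrossing h)
        (term_isCrossing hu) (term_open hu) (term_offLower_of_lt hv' h hu) hbox hw₀c

/-! ### The entry piece and the components, as good sets -/

/-- **The entry piece of the arm `i` at `zz`, as a good set.** For a site `zz` of the arm `i`
(`zz₀ > M`) such that the arm up to `zz` avoids the terms before `c = c_{u_j}` (`j ≠ i`), the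
piece inside the trapezoid ending at `zz` is a good set for `j` starting on `trapI M`, containing
`zz`, made of sites of the arm up to `zz`, meeting `trapO M` at most at `zz`. [folklore] -/
theorem exists_entry_goodSet (D : PairDataA M n k₀ K T ω) {zz : Site 2}
    (hzz : zz ∈ (D.A 1).support) (hz0 : (M : ℤ) < zz 0)
    (hstage : ∀ v' < D.uMin, ∀ c' z', (trapDomain M).lowestSeq ω v' = some (c', z') →
      ∀ t ∈ ((D.A 1).takeUntil zz hzz).support, t ∉ c') :
    ∃ P : Set (Site 2), D.GoodSet P ∧ (∃ f ∈ P, f ∈ trapI M) ∧ zz ∈ P ∧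
      (∀ v ∈ P, v ∈ ((D.A 1).takeUntil zz hzz).support) ∧ (∀ v ∈ P, v ∈ trapO M → v = zz) := by
  classical
  have hij : (1 : Fin 2) ≠ 0 := by decide
  obtain ⟨f, β, γ, -, hfI, -, hγD, hγsub⟩ := exists_entry_subwalk (D.A 1) (D.isPath 1) (fun v hv => D.norm_le hv)
    (D.a0_le 1) hzz hz0
  have hA : ∀ v ∈ γ.support, v ∈ (D.A 1).support := fun v hv => (D.A 1).support_takeUntil_subset_support hzz (hγsub v hv)
  refine ⟨{v | v ∈ γ.support}, ?_, ⟨f, γ.start_mem_support, hfI⟩, γ.end_mem_support, hγsub, fun v hv hvO => ?_⟩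
  · exact
      { sub_D := fun v hv => Finset.mem_coe.2 (hγD v hv)
        sub_ω := fun v hv => D.mem_omega (hA v hv)
        conn := siteConn_walk γ
        avoid := fun v hv hvα => D.disj' hij (hA v hv) (D.αF_subset v hvα)
        stage := fun v' hv' c' z' h v hv => hstage v' hv' c' z' h v (hγsub v hv) }
  · -- a site of `trapO` on the arm is its end, which lies in the prefix up to `zz` only if it is `zz`
    have hvA := hA v hv
    have hvn : triNorm v = 2 * M := by
      have h1 := (mem_trapO.1 hvO).2
      have h2 := D.norm_le hvA
      have h3 : v 0 ≤ triNorm v := by rw [triNorm_eq_max]; exact (le_max_left _ _).trans (le_max_left _ _)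
      omega
    have hvy : v = D.y 1 := D.clean 1 v hvA hvn
    by_contra hne
    have := notMem_takeUntil_of_mem_takeUntil (D.A 1) hzz (hγsub v hv) hne hvA
    subst hvy
    rw [takeUntil_end_eq_self (D.A 1) (D.isPath 1)] at this
    exact this hzz

/-- **The component of an unreached site of `c` off `zz`, as a good set**, not reached, adjacent
to `zz ∈ c`. [folklore] -/
theorem exists_comp_goodSet (D : PairDataA M n k₀ K T ω) {zz : Site 2}
    {c : Finset (Site 2)} {z : Site 2} (hu : (trapDomain M).lowestSeq ω D.uMin = some (c, z))
    (hzc : zz ∈ c) {a₀ : Site 2} (ha₀ : a₀ ∈ c) (ha₀z : a₀ ≠ zz) (ha₀R : a₀ ∉ D.Reach zz)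
    (hαR : ∀ v ∈ D.αF, v ∈ D.Reach zz) :
    ∃ L : Set (Site 2), D.GoodSet L ∧ a₀ ∈ L ∧ L ⊆ (↑c : Set (Site 2)) \ {zz} ∧ (∀ v ∈ L, v ∉ D.Reach zz) ∧
      ∃ a ∈ L, triGraph.Adj zz a := by
  have hc := term_isCrossing hu
  set L := siteComp ((↑c : Set (Site 2)) \ {zz}) a₀ with hL
  have ha₀L : a₀ ∈ L := mem_siteComp_self ⟨Finset.mem_coe.2 ha₀, ha₀z⟩
  have hLsub : L ⊆ (↑c : Set (Site 2)) \ {zz} := siteComp_subset _ _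
  have hLR : ∀ v ∈ L, v ∉ D.Reach zz := fun v hv hvR =>
    ha₀R (D.reach_of_pathIn hvR ((siteConn_siteComp _ _ v hv a₀ ha₀L).mono fun w hw =>
      ⟨D.term_subset_Aset hu (hLsub hw).1, (hLsub hw).2⟩))
  refine ⟨L, ?_, ha₀L, hLsub, hLR, ?_⟩
  · exact
      { sub_D := fun v hv => Finset.mem_coe.2 (hc.subset (hLsub hv).1)
        sub_ω := fun v hv => term_open hu (hLsub hv).1
        conn := siteConn_siteComp _ _
        avoid := fun v hv hvα => hLR v hv (hαR v hvα)
        stage := fun v' hv' c' z' h v hv hvc' => Finset.disjoint_left.1 (term_disjoint_of_lt hv' h hu) hvc' (hLsub hv).1 }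
  · obtain ⟨a, b, -, hb, -, hab, hpa⟩ := (hc.conn a₀ ha₀ zz hzc).exit (R := {v : Site 2 | v ≠ zz}) ha₀z (fun h => h rfl)
    have hb' : b = zz := by simpa using hb
    subst hb'
    exact ⟨a, hpa.mono fun w hw => ⟨hw.2, hw.1⟩, hab.symm⟩

/-! ### The theorem -/

/-- **A site of an arm is not a cut.** [cite: Nolin2008, §4.4 Lemma 15 (proof) (arXiv 0711.4948: Lemma 14, last paragraph)] -/
theorem not_isCut_of_mem_arm1 (D : PairDataA M n k₀ K T ω) {zz : Site 2} (hzz : zz ∈ (D.A 1).support) :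
    ¬ D.IsCut zz := by
  classical
  intro hcutz
  -- the arm `0`, its minimal term, the fence
  have hij : (1 : Fin 2) ≠ 0 := by decide
  obtain ⟨c, z, hu, hmeet⟩ := D.uMin_spec
  have hc := term_isCrossing hu
  have hzO := tip_mem hu
  set Tf := D.fence hu with hTf
  have hzF : zz ∉ Tf.F := fun hF => D.fence_disjoint_arm hu hF ⟨1, hzz⟩
  have hqR : Tf.q ∉ D.Reach zz := D.q_not_reach hcutz hu hzF
  have hzAj : zz ∉ (D.A 0).support := D.disj' hij hzz
  have hAjR : ∀ x ∈ (D.A 0).support, x ∈ D.Reach zz := D.arm_subset_reach 0 hzAj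
  obtain ⟨x, hx⟩ := hmeet
  rw [Finset.mem_inter] at hx
  have hxR : x ∈ D.Reach zz := hAjR x (D.αF_subset x hx.1)
  have hαR : ∀ v ∈ D.αF, v ∈ D.Reach zz := fun v hv => hAjR v (D.αF_subset v hv)
  -- a `trapO`-site of `c` is `z`; a `trapO`-site of the arm `i` is `y i`
  have hcO : ∀ v ∈ c, v ∈ trapO M → v = z := fun v hv hvO => hc.eq_tip v hv hvO
  ------------------------------------------------------------------
  -- CASE 1: `zz ∈ c` and an unreached site `a₀ ∈ c` adjacent-or-equal situation: the common sub-argument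
  have case_c : zz ∈ c → ∀ a₀ ∈ c, a₀ ∉ D.Reach zz →
      (∀ S : Set (Site 2), D.GoodSet S → (∃ f ∈ S, f ∈ trapI M) → zz ∈ S → a₀ ∈ S →
        (∀ v ∈ S, v ∈ trapO M → v = z) → False) → False := by
    intro hzc a₀ ha₀ ha₀R hfinish
    have hz0 : (M : ℤ) < zz 0 := (mem_trapD.1 (hc.subset hzc)).1
    have hstage := D.prefix_disjoint_earlier hcutz hzz hu hzc (SimpleGraph.Walk.end_mem_support _) (fun v hv _ => by
      simpa using hv)
    obtain ⟨P, hP, hPf, hzP, hPsub, hPO⟩ := D.exists_entry_goodSet hzz hz0 hstage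
    have hPO' : ∀ v ∈ P, v ∈ trapO M → v = z := fun v hv hvO => by
      have h1 := hPO v hv hvO; subst h1; exact hcO v hzc hvO
    by_cases ha₀z : a₀ = zz
    · subst ha₀z; exact hfinish P hP hPf hzP hzP hPO'
    · obtain ⟨L, hL, ha₀L, hLsub, -, a, haL, hadj⟩ := D.exists_comp_goodSet hu hzc ha₀ ha₀z ha₀R hαR
      refine hfinish (P ∪ L) (hP.union_of_adj hL hzP haL hadj) ?_ (Or.inl hzP) (Or.inr ha₀L) ?_
      · obtain ⟨f, hf, hfI⟩ := hPf; exact ⟨f, Or.inl hf, hfI⟩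
      · rintro v (hv | hv) hvO
        · exact hPO' v hv hvO
        · exact hcO v (hLsub hv).1 hvO
  -- with `a₀ = q ∈ c`: finish by `false_of_tip_mem` / `false_of_fence`
  have finish_q : ∀ S : Set (Site 2), D.GoodSet S → (∃ f ∈ S, f ∈ trapI M) → zz ∈ S → Tf.q ∈ S →
      (∀ v ∈ S, v ∈ trapO M → v = z) → zz ∈ c → False := by
    intro S hS hSf hzS hqS hSO hzc
    by_cases hzS' : z ∈ S
    · exact hS.false_of_tip_mem hu hSf hzS' hSO
    · exact hS.false_of_fence hu hSf (fun v hv hvO => hzS' ((hSO v hv hvO) ▸ hv)) hzS hzc hqS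
  ------------------------------------------------------------------
  rcases Tf.q_mem with hqc | ⟨i', hqA⟩
  · -- attached to the term: `zz ∈ c` (else `c`, reached through `x`, would contain the unreached `q`)
    have hqc' : Tf.q ∈ c := Finset.mem_coe.1 hqc
    have hzc : zz ∈ c := by
      by_contra hzc; exact hqR (D.term_subset_reach hu hzc hx.2 hxR _ hqc')
    exact case_c hzc Tf.q hqc' hqR fun S hS hSf hzS hqS hSO => finish_q S hS hSf hzS hqS hSO hzc
  -- attached to an arm: not the arm `0` (reached)
  by_cases hi' : i' = 0
  · rw [hi'] at hqA; exact hqR (hAjR _ hqA)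
  rw [fin2_eq_of_ne hij hi'] at hqA
  by_cases hqc : Tf.q ∈ c
  · have hzc : zz ∈ c := by
      by_contra hzc; exact hqR (D.term_subset_reach hu hzc hx.2 hxR _ hqc)
    exact case_c hzc Tf.q hqc hqR fun S hS hSf hzS hqS hSO => finish_q S hS hSf hzS hqS hSO hzc
  ------------------------------------------------------------------
  -- CASE 2: attached to the arm `i` off `c`, at or after `zz`
  have hzq : zz ∈ ((D.A 1).takeUntil Tf.q hqA).support := by
    by_contra hno; exact hqR (D.mem_reach_of_prefix 1 hqA hno)
  obtain ⟨hqlow, hqbox⟩ := D.attach_geom hu hqA hqc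
  have hk := D.one_le_kOf hu
  have hkM := D.kOf_le hu
  obtain ⟨ℓ, s, β, hℓs, γ', hdec, hℓc, -, hγ'p, -, hℓmem⟩ := exists_last_contact (D.raw hu) hk
    (by omega) hc (D.A 1) (D.isPath 1) (fun v hv => D.norm_le hv) (fun v hv => D.mem_omega hv)
    (D.a0_le_far 1 hu) hqA hqbox hqlow
  have hpath : ((D.A 1).takeUntil Tf.q hqA).IsPath := (D.isPath 1).takeUntil _
  have hℓq : ℓ ∈ ((D.A 1).takeUntil Tf.q hqA).support := hℓmem
  have hℓA : ℓ ∈ (D.A 1).support := (D.A 1).support_takeUntil_subset_support hqA hℓq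
  have hβeq : β = ((D.A 1).takeUntil Tf.q hqA).takeUntil ℓ hℓq := prefix_eq_takeUntil hpath hdec hℓq
  have htakeℓ : ((D.A 1).takeUntil Tf.q hqA).takeUntil ℓ hℓq = (D.A 1).takeUntil ℓ hℓA := SimpleGraph.Walk.takeUntil_takeUntil _ _ _
  have hβsupp : ∀ v, v ∈ β.support ↔ v ∈ ((D.A 1).takeUntil ℓ hℓA).support := fun v => by rw [hβeq, htakeℓ]
  have hright : ∀ v, v ∈ (SimpleGraph.Walk.cons hℓs γ').support ↔ v ∈ ((D.A 1).takeUntil Tf.q hqA).support ∧ (v ∉ β.support ∨ v = ℓ) :=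
    fun v => mem_support_right_iff hpath hdec
  have hℓγ' : ℓ ∉ γ'.support := ((SimpleGraph.Walk.cons_isPath_iff hℓs γ').1 ((isPath_append_iff'.1 (hdec ▸ hpath)).2.1)).2
  -- the piece `seg = ℓ … q` as a good set
  set seg : Set (Site 2) := {v | v ∈ (SimpleGraph.Walk.cons hℓs γ').support} with hseg
  have hsegq : ∀ v ∈ seg, v ∈ ((D.A 1).takeUntil Tf.q hqA).support := fun v hv => ((hright v).1 hv).1
  have hsegA : ∀ v ∈ seg, v ∈ (D.A 1).support := fun v hv => (D.A 1).support_takeUntil_subset_support hqA (hsegq v hv)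
  have hseg_cases : ∀ v ∈ seg, v = ℓ ∨ v ∈ γ'.support := fun v hv => by
    rw [hseg, Set.mem_setOf_eq, SimpleGraph.Walk.support_cons, List.mem_cons] at hv; exact hv
  have hsegGood : D.GoodSet seg :=
    { sub_D := fun v hv => by
        rcases hseg_cases v hv with h | h
        · subst h; exact Finset.mem_coe.2 (hc.subset hℓc)
        · exact Finset.mem_coe.2 (hγ'p v h).2.1
      sub_ω := fun v hv => D.mem_omega (hsegA v hv)
      conn := siteConn_walk _
      avoid := fun v hv hvα => D.disj' hij (hsegA v hv) (D.αF_subset v hvα)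
      stage := fun v' hv' c' z' h v hv hvc' => by
        rcases hseg_cases v hv with h' | h'
        · subst h'; exact Finset.disjoint_left.1 (term_disjoint_of_lt hv' h hu) hvc' hℓc
        · exact (hγ'p v h').1 (JDomain.mem_lower.2 (Or.inr (term_below_of_lt hv' h hu hvc'))) }
  have hqseg : Tf.q ∈ seg := SimpleGraph.Walk.end_mem_support _
  have hℓseg : ℓ ∈ seg := SimpleGraph.Walk.start_mem_support _
  -- a `trapO`-site of the arm `i` up to `q` is the end `y i`, and then `q = y i`
  have hOq : ∀ v ∈ ((D.A 1).takeUntil Tf.q hqA).support, v ∈ trapO M → v = D.y 1 ∧ Tf.q = D.y 1 := by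
    intro v hv hvO
    have hvA := (D.A 1).support_takeUntil_subset_support hqA hv
    have hvn : triNorm v = 2 * M := by
      have h1 := (mem_trapO.1 hvO).2
      have h2 := D.norm_le hvA
      have h3 : v 0 ≤ triNorm v := by rw [triNorm_eq_max]; exact (le_max_left _ _).trans (le_max_left _ _)
      omega
    have hvy : v = D.y 1 := D.clean 1 v hvA hvn
    refine ⟨hvy, ?_⟩
    by_contra hne
    have := notMem_takeUntil_of_mem_takeUntil (D.A 1) hqA hv (fun e => hne (by rw [← e, hvy])) hvA
    subst hvy
    rw [takeUntil_end_eq_self (D.A 1) (D.isPath 1)] at this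
    exact this hqA
  have hsegO : ∀ v ∈ seg, v ∈ trapO M → (v = ℓ ∧ ℓ = z) ∨ (v = Tf.q ∧ Tf.q = D.y 1) := by
    intro v hv hvO
    obtain ⟨hvy, hqy⟩ := hOq v (hsegq v hv) hvO
    rcases hseg_cases v hv with h | h
    · exact Or.inl ⟨h, hcO ℓ hℓc (h ▸ hvO)⟩
    · exact Or.inr ⟨by rw [hvy, hqy], hqy⟩
  -- if `q = y i` lies above the tip of `α_j`: Lemma A with `seg` alone
  have hq_high : Tf.q = D.y 1 → (D.y 0) 1 < (D.y 1) 1 → False := fun hqy hlt =>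
    hsegGood.not_mem_term hu hqseg (Finset.mem_union_right _ (mem_trapDomain_Jabove.2 ⟨by rw [hqy]; exact D.y1_mem_trapO_of_q_eq hu hqbox hqy, hqy ▸ hlt⟩))
      ℓ hℓseg hℓc
  have hyne : Tf.q = D.y 1 → (D.y 1) 1 ≠ (D.y 0) 1 := fun hqy h =>
    D.y_ne hij (eq_of_mem_trapO (D.y1_mem_trapO_of_q_eq hu hqbox hqy) D.y_mem h)
  -- the dispatcher: a good set `S` (from `trapI`, `trapO`-sites `= z`, `z ∉ S`) sharing a site with `seg`,
  -- with a `c`-site in `S ∪ seg`, is impossible when `ℓ ≠ z`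
  have dispatch : ℓ ≠ z → ∀ S : Set (Site 2), D.GoodSet S → (∃ f ∈ S, f ∈ trapI M) →
      (∀ v ∈ S, v ∈ trapO M → v = z ∨ (v = Tf.q ∧ Tf.q = D.y 1)) → z ∉ S → (∃ a ∈ S, a ∈ seg) →
      (∃ w₀ ∈ S ∪ seg, w₀ ∈ c) → False := by
    intro hℓz S hS hSf hSO hzS ⟨a, haS, haseg⟩ ⟨w₀, hw₀, hw₀c⟩
    have hS' : D.GoodSet (S ∪ seg) := hS.union_of_mem hsegGood haS haseg
    have hSf' : ∃ f ∈ S ∪ seg, f ∈ trapI M := by obtain ⟨f, hf, hfI⟩ := hSf; exact ⟨f, Or.inl hf, hfI⟩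
    have hO' : ∀ v ∈ S ∪ seg, v ∈ trapO M → v = Tf.q ∧ Tf.q = D.y 1 := by
      rintro v (hv | hv) hvO
      · rcases hSO v hv hvO with h | h
        · exact absurd (h ▸ hv) hzS
        · exact h
      · rcases hsegO v hv hvO with ⟨-, h2⟩ | h2
        · exact absurd h2 hℓz
        · exact h2
    by_cases hqy : Tf.q = D.y 1
    · rcases lt_or_gt_of_ne (hyne hqy) with hlt | hlt
      · exact hS'.false_of_tip hu hSf' (Or.inr hqseg) (by rw [hqy]; exact D.y1_mem_trapO_of_q_eq hu hqbox hqy) (fun v hv hvO => (hO' v hv hvO).1) (hqy ▸ hlt)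
      · exact hq_high hqy hlt
    · exact hS'.false_of_fence hu hSf' (fun v hv hvO => hqy (hO' v hv hvO).2) hw₀ hw₀c (Or.inr hqseg)
  -- `ℓ` is joined to `q` along `seg`; if `zz ∉ seg` this runs off `zz`
  have hℓq_path : zz ∉ seg → PathIn triGraph (D.Aset \ {zz}) ℓ Tf.q := fun hzseg =>
    (PathIn.of_walk_mem_support (SimpleGraph.Walk.cons hℓs γ') (A := D.Aset \ {zz})
      (fun v hv => ⟨D.armSet_subset_Aset (D.mem_armSet (hsegA v hv)), fun e => hzseg (e ▸ hv)⟩) (SimpleGraph.Walk.end_mem_support _)).1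
  ------------------------------------------------------------------
  -- position of `zz` in `takeUntil q = β ++ (ℓ :: γ')`
  by_cases hzℓ : zz = ℓ
  · -- `zz = ℓ ∈ c`
    subst hzℓ
    refine case_c hℓc zz hℓc (fun h => (D.reach_subset h).2 rfl) fun S hS hSf hzS _ hSO => ?_
    by_cases hzS' : z ∈ S
    · exact hS.false_of_tip_mem hu hSf hzS' hSO
    · have hℓz : zz ≠ z := fun e => hzS' (e ▸ hzS)
      exact dispatch hℓz S hS hSf (fun v hv hvO => Or.inl (hSO v hv hvO)) hzS' ⟨zz, hzS, hℓseg⟩ ⟨zz, Or.inl hzS, hℓc⟩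
  rcases (SimpleGraph.Walk.mem_support_append_iff _ _).1 (hdec ▸ hzq) with hzβ | hzγ
  · ----------------------------------------------------------------
    -- `zz` strictly before `ℓ`: `zz ∉ seg`, so `ℓ` unreached (else `q` reached); hence `zz ∈ c`
    have hzseg : zz ∉ seg := fun hz2 => by
      rcases ((hright zz).1 hz2).2 with h' | h'
      · exact h' hzβ
      · exact hzℓ h'
    have hℓR : ℓ ∉ D.Reach zz := fun h => hqR (D.reach_of_pathIn h (hℓq_path hzseg))
    have hzc : zz ∈ c := by
      by_contra hzc; exact hℓR (D.term_subset_reach hu hzc hx.2 hxR ℓ hℓc)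
    refine case_c hzc ℓ hℓc hℓR fun S hS hSf hzS hℓS hSO => ?_
    by_cases hzS' : z ∈ S
    · exact hS.false_of_tip_mem hu hSf hzS' hSO
    · have hℓz : ℓ ≠ z := fun e => hzS' (e ▸ hℓS)
      exact dispatch hℓz S hS hSf (fun v hv hvO => Or.inl (hSO v hv hvO)) hzS' ⟨ℓ, hℓS, hℓseg⟩ ⟨ℓ, Or.inl hℓS, hℓc⟩
  · ----------------------------------------------------------------
    -- `zz` after `ℓ`, on the piece off `lower c`
    have hzγ' : zz ∈ γ'.support := by
      rw [SimpleGraph.Walk.support_cons, List.mem_cons] at hzγ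
      rcases hzγ with h | h
      · exact absurd h hzℓ
      · exact h
    have hzseg : zz ∈ seg := List.mem_cons_of_mem _ hzγ'
    obtain ⟨hzlow, hzD, -, -⟩ := hγ'p zz hzγ'
    have hz0 : (M : ℤ) < zz 0 := (mem_trapD.1 hzD).1
    -- `ℓ` is at or before `zz`
    have hℓz : ℓ ∈ ((D.A 1).takeUntil zz hzz).support := by
      rcases mem_takeUntil_or (D.A 1) hzz hℓA with h | h
      · exact h
      · exfalso
        have hzβ : zz ∈ β.support := (hβsupp zz).2 h
        rcases ((hright zz).1 hzseg).2 with h' | h'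
        · exact h' hzβ
        · exact hzℓ h'
    -- every `lower c`-site of the arm up to `zz` is at or before `ℓ`
    have hbetween : ∀ v ∈ ((D.A 1).takeUntil zz hzz).support, v ∈ (trapDomain M).lower c z →
        v ∈ ((D.A 1).takeUntil ℓ ((D.A 1).support_takeUntil_subset_support hzz hℓz)).support := by
      intro v hv hvl
      have hvq : v ∈ ((D.A 1).takeUntil Tf.q hqA).support := support_takeUntil_subset_of_mem (D.A 1) hqA hzq hv
      rcases (SimpleGraph.Walk.mem_support_append_iff _ _).1 (hdec ▸ hvq) with hvβ | hvγ
      · exact (hβsupp v).1 hvβ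
      · rw [SimpleGraph.Walk.support_cons, List.mem_cons] at hvγ
        rcases hvγ with h | h
        · subst h; exact SimpleGraph.Walk.end_mem_support _
        · exact absurd hvl (hγ'p v h).1
    have hstage := D.prefix_disjoint_earlier hcutz hzz hu hℓc hℓz hbetween
    by_cases hℓz' : ℓ = z
    · -- the arm passes through the tip of `c` before `zz`: the entry piece at `ℓ` is a crossing with tip `z`
      have hℓ0 : (M : ℤ) < ℓ 0 := (mem_trapD.1 (hc.subset hℓc)).1
      have hstageℓ : ∀ v' < D.uMin, ∀ c' z', (trapDomain M).lowestSeq ω v' = some (c', z') →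
          ∀ t ∈ ((D.A 1).takeUntil ℓ hℓA).support, t ∉ c' := fun v' hv' c' z' h t ht =>
        hstage v' hv' c' z' h t (support_takeUntil_subset_of_mem (D.A 1) hzz hℓz ht)
      obtain ⟨P, hP, hPf, hℓP, -, hPO⟩ := D.exists_entry_goodSet hℓA hℓ0 hstageℓ
      exact hP.false_of_tip_mem hu hPf (hℓz' ▸ hℓP) (fun v hv hvO => (hPO v hv hvO).trans hℓz')
    · obtain ⟨P, hP, hPf, hzP, hPsub, hPO⟩ := D.exists_entry_goodSet hzz hz0 hstage
      have hzc : zz ∉ c := fun h => hzlow (JDomain.mem_lower.2 (Or.inl h))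
      have hPO' : ∀ v ∈ P, v ∈ trapO M → v = z ∨ (v = Tf.q ∧ Tf.q = D.y 1) := fun v hv hvO => by
        -- a `trapO`-site of `P` is `zz ∈ seg`: use `hsegO`
        have h1 := hPO v hv hvO
        subst h1
        rcases hsegO v hzseg hvO with ⟨h2, -⟩ | h2
        · exact absurd h2 hzℓ
        · exact Or.inr h2
      have hzP' : z ∉ P := fun h => hzc (by rw [← hPO z h hzO]; exact hc.tip_mem)
      exact dispatch hℓz' P hP hPf hPO' hzP' ⟨zz, hzP, hzseg⟩ ⟨ℓ, Or.inr hℓseg, hℓc⟩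

end PairDataA

end Literature.Probability.Percolation
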